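import Literature.Probability.Percolation.KozmaNitzanClusterProperty
import Literature.Probability.Percolation.LonelyClusterExchange
import HarnessLib

/-!
# Kozma–Nitzan's Theorem 9 (Conjecture 4 for the small-cluster thresholds `𝟙{|C| ≥ k}`, `k ≤ 4`)

Topic `Literature/Probability/Percolation`. Source: G. Kozma, S. Nitzan, *A reduction of the
`θ(p_c) = 0` problem to a conjectured inequality*, arXiv:2401.12397 (2024) [KozmaNitzan2024], §5.1
(pp. 31–32).  Everything in this file is PROVED, from the tree's reproduction of §2.2/§3.2/§5.1
(`KozmaNitzanClusterProperty.lean`: Lemma 3(ii) and Lemma 5 for monotone cluster properties, the star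
decomposition of the proof of Theorem 4) and of BHK's Theorem 1.5 (`LonelyClusterExchange.lean`:
`observerSet_le_of_lonelier`, `lonelyClusterTransfer_typeMinus`).

## Printed statements (read: `lit read arxiv:2401.12397`, pp. 31–32)

§5.1 (p. 31): a *monotone cluster property* is `f : G × {0,1}^{E(G)} → ℝ` with "(1) `f(v, ω)` depends
only on `C_ω(v)` the cluster of `v` in `ω`, and is increasing in it … (2) if `{v, w} ∈ ω` then
`f(v, ω) = f(w, ω)`"; "Examples of monotone cluster properties include `f(v, ω) = |C_ω(v)|`" (p. 32).

**Conjecture 4** (p. 32): "For any graph `G`, any monotone cluster property `f`, any `A ⊂ G` and any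
`0 ∈ G`, `E(f(0)·𝟙{0 ↔ A}) ≥ min_{a∈A} E(f(a)·𝟙{0 ↔ A})`."

**Theorem 9** (p. 32): "Conjecture 4 holds for the functions `f(g) = 𝟙{|C(g)| ≥ k}` for `k ≤ 4`, for
any `G` and `A`."  "We omit the proof of these theorems, as they do not contain any ideas which we did
not already use in § 3."  (`|C(g)|` is the number of VERTICES of the cluster, p. 4.)

**Theorem 10** (p. 32): "Assume conjecture 4 holds for the function `f(g) = |C(g)|`. Then conjecture 2
holds."  (Proof sketch, p. 32: hang `k` new vertices on `b` by weight-`1` edges.)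

## What is reproduced, and how

`KozmaNitzan2024_thm9_le_three`: Theorem 9 for the thresholds `k ≤ 3` — for every finite weighted
graph, every `A ≠ ∅` and every vertex `0`, some `a ∈ A` has
`P(|C(a)| ≥ k, 0 ↔ A) ≤ P(|C(0)| ≥ k, 0 ↔ A)`, i.e. `E(f(0)𝟙{0↔A}) ≥ min_a E(f(a)𝟙{0↔A})` for
`f = 𝟙{|C| ≥ k}`.  The printed proof being omitted, the proof here is assembled from the §3 tools exactly
as the paper indicates: with `a₀ ∈ A` minimising `P_{G∖{0}}(|C(a)| ≥ k)` (the choice of Theorem 4,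
p. 13), decompose along the stars `σ_B` of `0` over ALL `B ⊆ V ∖ {0}`
(`KNPreFKG.real_eq_sum_inter_starEvent` with the relay set `V ∖ {0}`, for which "`0` isolated off the
relays" is vacuous); a star meeting `A` is Lemma 5 for the monotone cluster property `|·| ≥ k`
(`KozmaNitzan2024_lemma5_cluster`, with any `v ∈ B ∩ A`); under a nonempty star `B` disjoint from `A`,
on `{0 ↔ A}` the cluster of `0` contains `0`, a vertex of `B` and a vertex of `A` — three distinct
vertices — so `𝟙{|C(0)| ≥ k} = 1` for `k ≤ 3` and the term is trivially dominated; the empty star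
does not meet `{0 ↔ A}`.

`KozmaNitzan2024_thm9_four` (and `KozmaNitzan2024_thm9`, all `k ≤ 4` as printed): the threshold
`k = 4`.  The stars of `0` are treated as for `k ≤ 3` except the single Steiner star `B = {x}`,
`x ∉ A`, under which `C(0) = {0} ∪ C_{G∖0}(x)` may have only three vertices.  Read on `G ∖ {0}` that
term is the *pendant-star inequality* `pendantStar_ge`:
`P(4 ≤ |C(a₀)| + 𝟙{x ↔ a₀}, x ↔ A) ≤ P(4 ≤ |C(x)| + 1, x ↔ A)` for a champion `a₀` of `A`
(`P(|C(a)| ≤ 3) ≤ P(|C(a₀)| ≤ 3)`, `a ∈ A`).  Its proof (`pendantStar_le`) is a second star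
decomposition, at `x`, each star `σ_T` being read on `G ∖ {0, x}` with `i` a champion of `A` there:
if `a₀` is one too, each star term is dominated using only the championship of `a₀` over the relay
`a'` when `T = {a'}` (`pendantStar_caseA_star`); otherwise each star term is dominated up to the same
star term of `P(|C(a₀)| ≤ 3) − P(|C(i)| ≤ 3)`, which sums to `≥ 0` by the championship of `a₀`
(`pendantStar_caseB_star`: a relay in `T` — BHK's Theorem 1.5 in the observer-set form
`observerSet_le_of_lonelier`; `T ≠ ∅` without relays — the transfer `lonelyClusterTransfer_typeMinus`
and `|C(T)| ≤ 2`; `T = ∅` — championship).  The printed proof being omitted ("[no] ideas which we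
did not already use in § 3"), this assembly is the tree's; every input is a §3 tool or BHK Thm. 1.5.

## What is NOT reproduced (why the printed cut-off is `k ≤ 4`)

* All `k`: by the device of Theorem 10 (hang `M ≥ |V|` pendant vertices on `b` with weight-`1` edges and
  take `k = M + 1`, so that `|C(v)| ≥ k ⟺ v ↔ b`), Conjecture 4 for every threshold `𝟙{|C| ≥ k}` implies
  the pre-FKG inequality (3), i.e. Conjecture 2 — the open problem of the paper.  So Theorem 9 cannot be
  expected for all `k` by the present methods; for `k = 5` already the double Steiner star `B = {x, y}`
  is no longer free.

Transcription (as in `KozmaNitzanClusterProperty.lean`): finite weighted graph = `w : Sym2 V → [0,1]` on a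
finite vertex type, `μ = prodBernoulli w`, `C_ω(x) = openCluster ω x` (a `Set V`; `|C| = Set.ncard`),
`{0 ↔ A} = ⋃_{a∈A} openConn 0 a`.

## Use in the tree

The engine crux `NoHeavyLowerTail` (stmt-CriticalPhenomena-4575) of `PercNearOneGluingNoHeavy` runs on the
"cumulative isolation" inequalities `P(1 ≤ |C(0)∩A| ≤ j) ≤ max_a P(|C(a)∩A| ≤ j)` (relay-BLOCK counts);
their conditioned form is Conjecture 4 for `f = 𝟙{|C(·) ∩ A| ≥ j+1}` (prim-cplus-engine, CST-gen3.md §2).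
Theorem 9 is the printed VERTEX-count counterpart; this file supplies it (`k ≤ 4`) as a theorem and
documents the calibration "all thresholds ⇒ Conjecture 2".
-/

noncomputable section

open MeasureTheory Set
open Literature.Probability.LatticeModels (prodBernoulli)

namespace Literature.Probability.Percolation

variable {V : Type*}

namespace KNPreFKG

/-- The threshold property `k ≤ |S|` is monotone on the subsets of a finite type.
[cite: KozmaNitzan2024, §5.1 (p. 32: "`f(v, ω) = |C_ω(v)|`" is a monotone cluster property)] -/
theorem le_ncard_mono [Finite V] (k : ℕ) :
    ∀ S T : Set V, S ⊆ T → k ≤ S.ncard → k ≤ T.ncard :=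
  fun _ T hST hS => hS.trans (Set.ncard_le_ncard hST (Set.toFinite T))

/-- Under the star `σ_B`, every vertex of `B` other than `0` lies in the cluster of `0`.
[cite: KozmaNitzan2024, Lemma 5 (p. 13)] -/
theorem mem_openCluster_of_mem_starEvent {ω : BondConfig V} {o : V} {B : Set V}
    (hσ : ω ∈ starEvent o B) {u : V} (huo : u ≠ o) (huB : u ∈ B) : u ∈ openCluster ω o := by
  have hou : s(o, u) ∈ ω := ((mem_starEvent_iff o B ω).1 hσ u huo).2 huB
  have hadj : (openGraph ω).Adj o u := (openGraph_adj ω o u).2 ⟨hou, huo.symm⟩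
  exact hadj.reachable

/-- Three pairwise distinct members force `3 ≤ |S|`. [folklore] -/
theorem three_le_ncard_of_mem [Finite V] {S : Set V} {x y z : V} (hx : x ∈ S) (hy : y ∈ S)
    (hz : z ∈ S) (hxy : x ≠ y) (hxz : x ≠ z) (hyz : y ≠ z) : 3 ≤ S.ncard := by
  have hsub : ({x, y, z} : Set V) ⊆ S := by
    intro v hv
    rcases hv with rfl | rfl | rfl
    · exact hx
    · exact hy
    · exact hz
  have h3 : ({x, y, z} : Set V).ncard = 3 := Set.ncard_eq_three.2 ⟨x, y, z, hxy, hxz, hyz, rfl⟩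
  calc 3 = ({x, y, z} : Set V).ncard := h3.symm
    _ ≤ S.ncard := Set.ncard_le_ncard hsub (Set.toFinite S)

/-- `{s ↔ A} = ⋃_{a ∈ A} {s ↔ a}` is the event that `C_s` lies in the upper family
`⋃_{a ∈ A} connFamily s a`. [cite: VandenbergHaggstromKahn2005, §1 p. 3] -/
theorem biUnion_openConn_eq_setOf_connFamily (s : V) (A : Finset V) :
    (⋃ a ∈ A, (openConn s a : Set (BondConfig V))) =
      {ω | openEdgeCluster ω s ∈ ⋃ a ∈ A, connFamily s a} := by
  ext ω
  simp only [mem_iUnion, exists_prop, mem_setOf_eq]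
  refine exists_congr fun a => and_congr_right fun _ => ?_
  exact reachable_iff_exists_mem_openEdgeCluster ω s a

/-- `⋃_{a ∈ A} connFamily s a` is an upper family. [folklore] -/
theorem isUpperSet_biUnion_connFamily (s : V) (A : Finset V) :
    IsUpperSet (⋃ a ∈ A, connFamily s a) :=
  isUpperSet_iUnion₂ fun a _ => isUpperSet_connFamily s a

end KNPreFKG

open KNPreFKG in
/-- **A relay no less lonely than the observer settles Conjecture 4 for the pair `(0, a)`** (any monotone
cluster property; the BHK mechanism of Kozma–Nitzan's Lemma 3, pp. 6–7).  If `P` is a monotone predicate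
on vertex sets, `a ∈ A`, and `P(P(C(a))) ≤ P(P(C(0)))`, then `P(P(C(a)), 0 ↔ A) ≤ P(P(C(0)), 0 ↔ A)`.
Proof: on `{0 ↔ a}` the two events coincide; on `D = {0 ↮ a}` the hypothesis persists, `{0 ↔ A}` is
increasing in `C_0`, so BHK Thm. 1.4 (increasing in `C_0` × increasing in `C_a`, negatively correlated
given `D`) and Thm. 1.3 (two increasing events of `C_0`, positively correlated given `D`) give
`μ(D, P(C(a)), 0↔A)·μ(D) ≤ μ(D, 0↔A)·μ(D, P(C(a))) ≤ μ(D, 0↔A)·μ(D, P(C(0))) ≤ μ(D)·μ(D, P(C(0)), 0↔A)`.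
In particular Conjecture 4 for `f = 𝟙[P(C(·))]` (e.g. every threshold `𝟙{|C| ≥ k}`) can only fail at
an observer `0` that is "lonelier" than every relay: `P(P(C(0))) < min_{a∈A} P(P(C(a)))`.
[cite: KozmaNitzan2024, Lemma 3 (pp. 6–7) and Conjecture 4 (p. 32); VandenbergHaggstromKahn2005, Thms. 1.3–1.4] -/
theorem KozmaNitzan2024_clusterProperty_conn_le_of_le {V : Type*} [Fintype V]
    (w : Sym2 V → unitInterval) (A : Finset V) (o a : V) (ha : a ∈ A) (P : Set V → Prop)
    (hP : ∀ S T : Set V, S ⊆ T → P S → P T)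
    (h : (prodBernoulli w).real {ω | P (openCluster ω a)} ≤
      (prodBernoulli w).real {ω | P (openCluster ω o)}) :
    (prodBernoulli w).real ({ω | P (openCluster ω a)} ∩ ⋃ a' ∈ A, openConn o a') ≤
      (prodBernoulli w).real ({ω | P (openCluster ω o)} ∩ ⋃ a' ∈ A, openConn o a') := by
  classical
  set μ := prodBernoulli w with hμ
  set Xa : Set (BondConfig V) := {ω | P (openCluster ω a)} with hXa
  set Xo : Set (BondConfig V) := {ω | P (openCluster ω o)} with hXo
  set E : Set (BondConfig V) := ⋃ a' ∈ A, (openConn o a' : Set (BondConfig V)) with hE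
  by_cases hoa : o = a
  · subst hoa
    exact le_rfl
  set D : Set (BondConfig V) := {ω | ¬ (openGraph ω).Reachable o a} with hD
  -- on `Dᶜ` the two events agree (same cluster)
  have hagree : Xa ∩ Dᶜ = Xo ∩ Dᶜ := by
    ext ω
    simp only [mem_inter_iff, mem_compl_iff, mem_setOf_eq, not_not, hXa, hXo, hD]
    constructor
    · rintro ⟨h1, h2⟩
      exact ⟨by rwa [openCluster_eq_of_reachable h2], h2⟩
    · rintro ⟨h1, h2⟩
      exact ⟨by rwa [← openCluster_eq_of_reachable h2], h2⟩
  have hsplit : ∀ S : Set (BondConfig V), μ.real S = μ.real (S ∩ D) + μ.real (S ∩ Dᶜ) := by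
    intro S
    rw [← measureReal_inter_add_sdiff (s := S) (MeasurableSet.of_discrete : MeasurableSet D),
      Set.sdiff_eq]
  -- the hypothesis restricted to `D`
  have hH : μ.real (D ∩ Xa) ≤ μ.real (D ∩ Xo) := by
    have h' := h
    change μ.real Xa ≤ μ.real Xo at h'
    rw [hsplit Xa, hsplit Xo, hagree] at h'
    rw [inter_comm D Xa, inter_comm D Xo]
    linarith
  -- the events in edge-cluster form
  have hXae : Xa = {ω | openEdgeCluster ω a ∈ {C : Set (Sym2 V) | P {y | y = a ∨ ∃ e ∈ C, y ∈ e}}} :=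
    setOf_prop_openCluster_eq a P
  have hXoe : Xo = {ω | openEdgeCluster ω o ∈ {C : Set (Sym2 V) | P {y | y = o ∨ ∃ e ∈ C, y ∈ e}}} :=
    setOf_prop_openCluster_eq o P
  have hEe : E = {ω | openEdgeCluster ω o ∈ ⋃ a' ∈ A, connFamily o a'} :=
    biUnion_openConn_eq_setOf_connFamily o A
  -- (1) two-cluster BHK (Thm. 1.4): `{0 ↔ A}` (in `C_0`) and `P(C(a))` (in `C_a`), given `D`
  have h1 := bhk_two_upper_upper w o a hoa (isUpperSet_biUnion_connFamily o A)
    (isUpperSet_clusterPropFamily a P hP)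
  rw [← hEe, ← hXae] at h1
  -- (2) one-cluster BHK (Thm. 1.3): `{0 ↔ A}` and `P(C(0))`, both increasing in `C_0`, given `D`
  have hD1 : {ω : BondConfig V | ∀ x ∈ ({a} : Set V), ¬ (openGraph ω).Reachable o x} = D := by
    ext ω
    simp [hD]
  have h2 := bhk_one_upper_upper w o ({a} : Set V) (by simpa using hoa)
    (isUpperSet_biUnion_connFamily o A) (isUpperSet_clusterPropFamily o P hP)
  rw [hD1, ← hEe, ← hXoe] at h2
  -- the inequality on `D`
  have hcore : μ.real (Xa ∩ E ∩ D) ≤ μ.real (Xo ∩ E ∩ D) := by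
    have hL : Xa ∩ E ∩ D = D ∩ (E ∩ Xa) := by
      ext ω; simp only [mem_inter_iff]; tauto
    have hR : Xo ∩ E ∩ D = D ∩ (E ∩ Xo) := by
      ext ω; simp only [mem_inter_iff]; tauto
    rw [hL, hR]
    by_cases hD0 : μ.real D = 0
    · have h0 : μ.real (D ∩ (E ∩ Xa)) = 0 :=
        le_antisymm ((measureReal_mono inter_subset_left).trans hD0.le) measureReal_nonneg
      rw [h0]
      exact measureReal_nonneg
    · have hDpos : 0 < μ.real D := lt_of_le_of_ne measureReal_nonneg (Ne.symm hD0)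
      have hchain : μ.real D * μ.real (D ∩ (E ∩ Xa)) ≤ μ.real D * μ.real (D ∩ (E ∩ Xo)) := by
        calc μ.real D * μ.real (D ∩ (E ∩ Xa))
            ≤ μ.real (D ∩ E) * μ.real (D ∩ Xa) := h1
          _ ≤ μ.real (D ∩ E) * μ.real (D ∩ Xo) := mul_le_mul_of_nonneg_left hH measureReal_nonneg
          _ ≤ μ.real D * μ.real (D ∩ (E ∩ Xo)) := h2
      exact le_of_mul_le_mul_left hchain hDpos
  have hagreeE : Xa ∩ E ∩ Dᶜ = Xo ∩ E ∩ Dᶜ := by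
    rw [inter_right_comm, hagree, inter_right_comm]
  change μ.real (Xa ∩ E) ≤ μ.real (Xo ∩ E)
  calc μ.real (Xa ∩ E) = μ.real (Xa ∩ E ∩ D) + μ.real (Xa ∩ E ∩ Dᶜ) := hsplit _
    _ ≤ μ.real (Xo ∩ E ∩ D) + μ.real (Xo ∩ E ∩ Dᶜ) := by rw [hagreeE]; linarith [hcore]
    _ = μ.real (Xo ∩ E) := (hsplit (Xo ∩ E)).symm

open KNPreFKG in
/-- **Kozma–Nitzan 2024, Theorem 9, thresholds `k ≤ 3`** (p. 32: "Conjecture 4 holds for the functions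
`f(g) = 𝟙{|C(g)| ≥ k}` for `k ≤ 4`, for any `G` and `A`"; Conjecture 4, p. 32:
"`E(f(0)·𝟙{0 ↔ A}) ≥ min_{a∈A} E(f(a)·𝟙{0 ↔ A})`"; proof omitted in print).  For every finite weighted
graph, every nonempty `A` and every vertex `0`: if `k ≤ 3` then some `a ∈ A` has
`P(|C(a)| ≥ k, 0 ↔ A) ≤ P(|C(0)| ≥ k, 0 ↔ A)`.  Proof (the §3 tools, as the paper indicates): `a₀ ∈ A`
minimising `P_{G∖{0}}(|C(a)| ≥ k)`; decompose along the stars `σ_B`, `B ⊆ V ∖ {0}`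
(`real_eq_sum_inter_starEvent`); `B ∩ A ≠ ∅`: Lemma 5 for the monotone cluster property `|·| ≥ k`
(`KozmaNitzan2024_lemma5_cluster`) and `σ_B ⊆ {0 ↔ A}`; `B ≠ ∅`, `B ∩ A = ∅`: on `σ_B ∩ {0 ↔ A}` the
cluster of `0` contains `0`, a vertex of `B` and a vertex of `A`, so `|C(0)| ≥ 3 ≥ k`; `B = ∅`: `0 ↮ A`.
The case `k = 4` of the printed theorem is `KozmaNitzan2024_thm9_four` below.
[cite: KozmaNitzan2024, Thm. 9 (p. 32) with Conjecture 4 (p. 32), Lemma 5 (p. 13), Thm. 4 (pp. 12–14)] -/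
theorem KozmaNitzan2024_thm9_le_three {V : Type*} [Fintype V] (w : Sym2 V → unitInterval)
    (A : Finset V) (o : V) (k : ℕ) (hk : k ≤ 3) (hA : A.Nonempty) :
    ∃ a ∈ A, (prodBernoulli w).real ({ω | k ≤ (openCluster ω a).ncard} ∩ ⋃ a' ∈ A, openConn o a') ≤
      (prodBernoulli w).real ({ω | k ≤ (openCluster ω o).ncard} ∩ ⋃ a' ∈ A, openConn o a') := by
  classical
  set μ := prodBernoulli w with hμ
  by_cases hoA : o ∈ A
  · exact ⟨o, hoA, le_rfl⟩
  -- the monotone cluster property `|·| ≥ k`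
  set P : Set V → Prop := fun S => k ≤ S.ncard with hPdef
  have hP : ∀ S T : Set V, S ⊆ T → P S → P T := le_ncard_mono k
  -- `a₀` minimising `P_{G ∖ {0}}(|C(a)| ≥ k)` over `A`
  obtain ⟨a₀, ha₀, hmin⟩ := A.exists_min_image
    (fun a => μ.real {ω | P {y | ω ∈ openConnIn ({o}ᶜ : Set V) a y}}) hA
  refine ⟨a₀, ha₀, ?_⟩
  have ha₀o : a₀ ≠ o := fun h => hoA (h ▸ ha₀)
  -- the stars of `0` over ALL `B ⊆ V ∖ {0}` partition the space
  set U : Finset V := Finset.univ.erase o with hU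
  have hoU : o ∉ U := fun h => (Finset.mem_erase.1 h).1 rfl
  have hisoU : ∀ u, u ≠ o → u ∉ U → w s(o, u) = 0 :=
    fun u huo huU => absurd (Finset.mem_erase.2 ⟨huo, Finset.mem_univ u⟩) huU
  change μ.real ({ω | P (openCluster ω a₀)} ∩ ⋃ a' ∈ A, openConn o a') ≤
    μ.real ({ω | P (openCluster ω o)} ∩ ⋃ a' ∈ A, openConn o a')
  rw [real_eq_sum_inter_starEvent w U o hoU hisoU ({ω | P (openCluster ω a₀)} ∩ _),
    real_eq_sum_inter_starEvent w U o hoU hisoU ({ω | P (openCluster ω o)} ∩ _)]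
  refine Finset.sum_le_sum fun B hB => ?_
  have hBU : B ⊆ U := Finset.mem_powerset.1 hB
  have hBo : ∀ u ∈ B, u ≠ o := fun u hu h => hoU (h ▸ hBU hu)
  by_cases hBA : ∃ v ∈ B, v ∈ A
  · -- a star meeting `A`: Lemma 5 with `v ∈ B ∩ A`, and `σ_B ⊆ {0 ↔ v} ⊆ {0 ↔ A}`
    obtain ⟨v, hvB, hvA⟩ := hBA
    have hvo : v ≠ o := hBo v hvB
    have L5 := KozmaNitzan2024_lemma5_cluster w o a₀ v (↑B) P hP ha₀o hvo (Finset.mem_coe.2 hvB)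
      (hmin v hvA)
    have hσU : starEvent o (↑B : Set V) ⊆ ⋃ a' ∈ A, (openConn o a' : Set (BondConfig V)) := by
      intro ω hσ
      exact mem_iUnion₂.2 ⟨v, hvA, mem_openCluster_of_mem_starEvent hσ hvo (Finset.mem_coe.2 hvB)⟩
    calc μ.real (({ω | P (openCluster ω a₀)} ∩ ⋃ a' ∈ A, openConn o a') ∩ starEvent o ↑B)
        ≤ μ.real ({ω | P (openCluster ω a₀)} ∩ starEvent o ↑B) :=
          measureReal_mono fun ω ⟨⟨h1, _⟩, h2⟩ => ⟨h1, h2⟩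
      _ ≤ μ.real ({ω | P (openCluster ω o)} ∩ starEvent o ↑B) := L5
      _ ≤ μ.real (({ω | P (openCluster ω o)} ∩ ⋃ a' ∈ A, openConn o a') ∩ starEvent o ↑B) :=
          measureReal_mono fun ω ⟨h1, h2⟩ => ⟨⟨h1, hσU h2⟩, h2⟩
  · push Not at hBA
    rcases B.eq_empty_or_nonempty with rfl | ⟨u, hu⟩
    · -- the empty star: `0 ↮ A`, the term vanishes
      have h0 : ({ω | P (openCluster ω a₀)} ∩ ⋃ a' ∈ A, openConn o a') ∩ starEvent o ↑(∅ : Finset V) =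
          (∅ : Set (BondConfig V)) := by
        ext ω
        simp only [mem_inter_iff, mem_iUnion, exists_prop, mem_empty_iff_false, iff_false, not_and]
        rintro ⟨-, a', ha', hoa'⟩ hσ
        rw [Finset.coe_empty] at hσ
        exact not_reachable_of_mem_starEvent_empty hσ (fun h => hoA (h ▸ ha')) hoa'
      rw [h0, measureReal_empty]
      exact measureReal_nonneg
    · -- a nonempty star missing `A`: on `{0 ↔ A}`, `C(0) ∋ 0, u, a'` — three distinct vertices
      have huo : u ≠ o := hBo u hu
      have huA : u ∉ A := hBA u hu
      refine measureReal_mono ?_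
      rintro ω ⟨⟨-, hE⟩, hσ⟩
      obtain ⟨a', ha', hoa'⟩ := mem_iUnion₂.1 hE
      have ha'o : a' ≠ o := fun h => hoA (h ▸ ha')
      have ha'u : a' ≠ u := fun h => huA (h ▸ ha')
      refine ⟨⟨?_, hE⟩, hσ⟩
      change k ≤ (openCluster ω o).ncard
      have h3 : 3 ≤ (openCluster ω o).ncard :=
        three_le_ncard_of_mem (mem_openCluster_self ω o)
          (mem_openCluster_of_mem_starEvent hσ huo (Finset.mem_coe.2 hu)) hoa'
          huo.symm ha'o.symm ha'u.symm
      exact hk.trans h3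

/-- **Theorem 9, thresholds `k ≤ 3`, in the "`E f(0)𝟙 ≥ min_a E f(a)𝟙`" wording of Conjecture 4**:
the minimum over `A` of `P(|C(a)| ≥ k, 0 ↔ A)` is at most `P(|C(0)| ≥ k, 0 ↔ A)`.
[cite: KozmaNitzan2024, Thm. 9 and Conjecture 4 (p. 32)] -/
theorem KozmaNitzan2024_thm9_le_three_inf {V : Type*} [Fintype V] (w : Sym2 V → unitInterval)
    (A : Finset V) (o : V) (k : ℕ) (hk : k ≤ 3) (hA : A.Nonempty) :
    A.inf' hA (fun a => (prodBernoulli w).real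
        ({ω | k ≤ (openCluster ω a).ncard} ∩ ⋃ a' ∈ A, openConn o a')) ≤
      (prodBernoulli w).real ({ω | k ≤ (openCluster ω o).ncard} ∩ ⋃ a' ∈ A, openConn o a') := by
  obtain ⟨a, ha, h⟩ := KozmaNitzan2024_thm9_le_three w A o k hk hA
  exact (Finset.inf'_le _ ha).trans h


/-! ## Theorem 9 at `k = 4`: the single Steiner star and the pendant-star inequality -/

section KFour

open scoped Classical

namespace KNPreFKG

/-- `|C(c)|` as the cardinality of a filter of `univ` (bridge to the relay-count events of
`LonelyClusterExchange.lean` with every vertex a relay). [folklore] -/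
theorem card_filter_univ_openConn [Fintype V] (ω : BondConfig V) (c : V) :
    (Finset.univ.filter fun z => ω ∈ openConn c z).card = (openCluster ω c).ncard := by
  rw [← Set.ncard_coe_finset]
  congr 1
  ext z
  simp only [Finset.coe_filter, Finset.mem_univ, true_and, mem_setOf_eq, openCluster, openConn]

/-- `|C(O)|`, the number of vertices joined to the set `O`, as the cardinality of a filter of `univ`.
[folklore] -/
theorem card_filter_univ_exists_openConn [Fintype V] (ω : BondConfig V) (O : Finset V) :
    (Finset.univ.filter fun z => ∃ x ∈ O, ω ∈ openConn x z).card =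
      ({z | ∃ x ∈ O, (openGraph ω).Reachable x z} : Set V).ncard := by
  rw [← Set.ncard_coe_finset]
  congr 1
  ext z
  simp only [Finset.coe_filter, Finset.mem_univ, true_and, mem_setOf_eq, openConn]

/-- The loneliness event `{|C(v)| ≤ j}` in relay-count form with every vertex a relay. [folklore] -/
theorem setOf_ncard_le_eq_filter [Fintype V] (v : V) (j : ℕ) :
    ({ω | (openCluster ω v).ncard ≤ j} : Set (BondConfig V)) =
      {ω | (Finset.univ.filter fun z => ω ∈ openConn v z).card ≤ j} := by
  ext ω
  rw [mem_setOf_eq, mem_setOf_eq, card_filter_univ_openConn]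

section Measure

variable [Fintype V]

/-- **Restricted championship.** If `P(|C(y)| ≤ j) ≤ P(|C(c)| ≤ j)` then the same holds on
`{y ↮ c}`: on `{y ↔ c}` the two clusters coincide. [folklore] -/
theorem real_inter_compl_openConn_le_of_le (w : Sym2 V → unitInterval) (y c : V) (j : ℕ)
    (hle : (prodBernoulli w).real {ω | (openCluster ω y).ncard ≤ j} ≤
      (prodBernoulli w).real {ω | (openCluster ω c).ncard ≤ j}) :
    (prodBernoulli w).real ({ω | (openCluster ω y).ncard ≤ j} ∩ (openConn y c)ᶜ) ≤
      (prodBernoulli w).real ({ω | (openCluster ω c).ncard ≤ j} ∩ (openConn y c)ᶜ) := by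
  set μ := prodBernoulli w with hμ
  set Ry : Set (BondConfig V) := {ω | (openCluster ω y).ncard ≤ j} with hRy
  set Rc : Set (BondConfig V) := {ω | (openCluster ω c).ncard ≤ j} with hRc
  set D : Set (BondConfig V) := (openConn y c)ᶜ with hD
  have hmD : MeasurableSet D := MeasurableSet.of_discrete
  have h1 : μ.real (Ry ∩ D) + μ.real (Ry \ D) = μ.real Ry := measureReal_inter_add_sdiff (μ := μ) hmD
  have h2 : μ.real (Rc ∩ D) + μ.real (Rc \ D) = μ.real Rc := measureReal_inter_add_sdiff (μ := μ) hmD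
  have h3 : Ry \ D = Rc \ D := by
    ext ω
    simp only [hRy, hRc, hD, mem_sdiff, mem_compl_iff, not_not, mem_setOf_eq]
    constructor
    · rintro ⟨h, hyc⟩
      exact ⟨by rwa [← openCluster_eq_of_reachable (show (openGraph ω).Reachable y c from hyc)], hyc⟩
    · rintro ⟨h, hyc⟩
      exact ⟨by rwa [openCluster_eq_of_reachable (show (openGraph ω).Reachable y c from hyc)], hyc⟩
  rw [h3] at h1
  linarith

/-- **Championship survives cutting the champion from a set** (from the lonely-cluster transfer,
BHK Thm. 1.5): if `s ≠ t` and `P(|C(s)| ≤ j) ≤ P(|C(t)| ≤ j)`, then for every vertex set `T`,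
`P(|C(s)| ≤ j, t ↮ T) ≤ P(|C(t)| ≤ j, t ↮ T)`. [cite: VandenbergHaggstromKahn2005, Thm. 1.5 (p. 7) — corollary] -/
theorem real_inter_notConn_le_of_le (w : Sym2 V → unitInterval) {s t : V} (hst : s ≠ t)
    (T : Finset V) (j : ℕ)
    (hle : (prodBernoulli w).real {ω | (openCluster ω s).ncard ≤ j} ≤
      (prodBernoulli w).real {ω | (openCluster ω t).ncard ≤ j}) :
    (prodBernoulli w).real ({ω | (openCluster ω s).ncard ≤ j} ∩ {ω | ∀ u ∈ T, ω ∉ openConn t u}) ≤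
      (prodBernoulli w).real ({ω | (openCluster ω t).ncard ≤ j} ∩
        {ω | ∀ u ∈ T, ω ∉ openConn t u}) := by
  set μ := prodBernoulli w with hμ
  set Rs : Set (BondConfig V) := {ω | (openCluster ω s).ncard ≤ j} with hRs
  set Rt : Set (BondConfig V) := {ω | (openCluster ω t).ncard ≤ j} with hRt
  set N : Set (BondConfig V) := {ω | ∀ u ∈ T, ω ∉ openConn t u} with hN
  set B : Set (BondConfig V) := {ω | ∃ u ∈ T, ω ∈ openConn t u} with hB
  set D : Set (BondConfig V) := (openConn s t)ᶜ with hD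
  have hmeas : ∀ S : Set (BondConfig V), MeasurableSet S := fun S => MeasurableSet.of_discrete
  have hNB : N = Bᶜ := by
    ext ω
    simp only [hN, hB, mem_setOf_eq, mem_compl_iff, not_exists, not_and]
  -- `B = {t ↔ T}` is of type `(−)` for the pair `(s, t)`
  have hBtype : ∀ ⦃ω ω' : BondConfig V⦄, openEdgeCluster ω' s ⊆ openEdgeCluster ω s →
      openEdgeCluster ω t ⊆ openEdgeCluster ω' t → ω ∈ B → ω' ∈ B := by
    intro ω ω' h1 h2 hω
    obtain ⟨u, hu, hωu⟩ := hω
    exact ⟨u, hu, typeMinus_openConn s t u h1 h2 hωu⟩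
  have hle' : μ.real {ω | (Finset.univ.filter fun z => ω ∈ openConn s z).card ≤ j} ≤
      μ.real {ω | (Finset.univ.filter fun z => ω ∈ openConn t z).card ≤ j} := by
    rw [← setOf_ncard_le_eq_filter, ← setOf_ncard_le_eq_filter]
    exact hle
  have key := lonelyClusterTransfer_typeMinus w hst Finset.univ j hBtype hle'
  rw [← setOf_ncard_le_eq_filter, ← setOf_ncard_le_eq_filter] at key
  change μ.real (D ∩ (Rt ∩ B)) ≤ μ.real (D ∩ (B ∩ Rs)) + (μ.real Rt - μ.real Rs) at key
  -- on `{s ↔ t}` the two loneliness events coincide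
  have hRD : Rt \ D = Rs \ D := by
    ext ω
    simp only [hRt, hRs, hD, mem_sdiff, mem_compl_iff, not_not, mem_setOf_eq]
    constructor
    · rintro ⟨h, hst'⟩
      exact ⟨by rwa [openCluster_eq_of_reachable (show (openGraph ω).Reachable s t from hst')], hst'⟩
    · rintro ⟨h, hst'⟩
      exact ⟨by rwa [← openCluster_eq_of_reachable (show (openGraph ω).Reachable s t from hst')],
        hst'⟩
  have hRND : (Rt ∩ N) \ D = (Rs ∩ N) \ D := by
    ext ω
    have h := Set.ext_iff.1 hRD ω
    simp only [mem_sdiff, mem_inter_iff] at h ⊢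
    tauto
  have e1 : μ.real (Rt ∩ D) + μ.real (Rt \ D) = μ.real Rt := measureReal_inter_add_sdiff (μ := μ) (hmeas D)
  have e2 : μ.real (Rs ∩ D) + μ.real (Rs \ D) = μ.real Rs := measureReal_inter_add_sdiff (μ := μ) (hmeas D)
  have e3 : μ.real (Rt ∩ D ∩ B) + μ.real ((Rt ∩ D) \ B) = μ.real (Rt ∩ D) :=
    measureReal_inter_add_sdiff (μ := μ) (hmeas B)
  have e4 : μ.real (Rs ∩ D ∩ B) + μ.real ((Rs ∩ D) \ B) = μ.real (Rs ∩ D) :=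
    measureReal_inter_add_sdiff (μ := μ) (hmeas B)
  have e5 : μ.real (Rt ∩ N ∩ D) + μ.real ((Rt ∩ N) \ D) = μ.real (Rt ∩ N) :=
    measureReal_inter_add_sdiff (μ := μ) (hmeas D)
  have e6 : μ.real (Rs ∩ N ∩ D) + μ.real ((Rs ∩ N) \ D) = μ.real (Rs ∩ N) :=
    measureReal_inter_add_sdiff (μ := μ) (hmeas D)
  have s1 : D ∩ (Rt ∩ B) = Rt ∩ D ∩ B := by
    ext ω; simp only [mem_inter_iff]; tauto
  have s2 : D ∩ (B ∩ Rs) = Rs ∩ D ∩ B := by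
    ext ω; simp only [mem_inter_iff]; tauto
  have s3 : (Rt ∩ D) \ B = Rt ∩ N ∩ D := by
    rw [hNB]; ext ω; simp only [mem_inter_iff, mem_sdiff, mem_compl_iff]; tauto
  have s4 : (Rs ∩ D) \ B = Rs ∩ N ∩ D := by
    rw [hNB]; ext ω; simp only [mem_inter_iff, mem_sdiff, mem_compl_iff]; tauto
  rw [s1, s2] at key
  rw [s3] at e3
  rw [s4] at e4
  rw [hRD] at e1
  rw [hRND] at e5
  linarith

/-- **Theorem A for vertex counts, folded into the glued cluster.** If `y ∈ T` and
`P(|C(y)| ≤ j) ≤ P(|C(c)| ≤ j)`, then `P(|C(T)| + 1 ≤ j) ≤ P((c ↮ T ∧ |C(c)| ≤ j) ∨ (c ↔ T ∧ |C(T)| + 1 ≤ j))`,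
`C(T)` the set of vertices joined to `T`. [cite: VandenbergHaggstromKahn2005, Thm. 1.5 (p. 7) — corollary via `observerSet_le_of_lonelier`] -/
theorem real_glued_le_of_lonelier (w : Sym2 V → unitInterval) (T : Finset V) (y c : V) (hy : y ∈ T)
    (j : ℕ)
    (hle : (prodBernoulli w).real {ω | (openCluster ω y).ncard ≤ j} ≤
      (prodBernoulli w).real {ω | (openCluster ω c).ncard ≤ j}) :
    (prodBernoulli w).real {ω | ({z | ∃ u ∈ T, (openGraph ω).Reachable u z} : Set V).ncard + 1 ≤ j} ≤
      (prodBernoulli w).real {ω |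
        ((¬ ∃ u ∈ T, (openGraph ω).Reachable u c) ∧ (openCluster ω c).ncard ≤ j) ∨
        ((∃ u ∈ T, (openGraph ω).Reachable u c) ∧
          ({z | ∃ u ∈ T, (openGraph ω).Reachable u z} : Set V).ncard + 1 ≤ j)} := by
  set μ := prodBernoulli w with hμ
  set L : Set (BondConfig V) :=
    {ω | ({z | ∃ u ∈ T, (openGraph ω).Reachable u z} : Set V).ncard + 1 ≤ j} with hL
  set N : Set (BondConfig V) := {ω | ¬ ∃ u ∈ T, (openGraph ω).Reachable u c} with hN
  set Rc : Set (BondConfig V) := {ω | (openCluster ω c).ncard ≤ j} with hRc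
  have hmeas : ∀ S : Set (BondConfig V), MeasurableSet S := fun S => MeasurableSet.of_discrete
  have hle' : μ.real {ω | (Finset.univ.filter fun z => ω ∈ openConn y z).card ≤ j} ≤
      μ.real {ω | (Finset.univ.filter fun z => ω ∈ openConn c z).card ≤ j} := by
    rw [← setOf_ncard_le_eq_filter, ← setOf_ncard_le_eq_filter]
    exact hle
  have TA := observerSet_le_of_lonelier w Finset.univ T y c hy j hle'
  -- `L ∩ N ⊆` the left event of Theorem A, whose right event is `N ∩ Rc`
  have hA1 : μ.real (L ∩ N) ≤ μ.real (N ∩ Rc) := by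
    refine le_trans (measureReal_mono ?_) (TA.trans (measureReal_mono ?_))
    · rintro ω ⟨hωL, hωN⟩
      refine ⟨fun x hx hcx => hωN ⟨x, hx, ?_⟩, ?_, ?_⟩
      · exact (show (openGraph ω).Reachable c x from hcx).symm
      · refine Finset.card_pos.2 ⟨y, Finset.mem_filter.2 ⟨Finset.mem_univ y, y, hy, ?_⟩⟩
        exact (SimpleGraph.Reachable.refl y : (openGraph ω).Reachable y y)
      · rw [card_filter_univ_exists_openConn]
        have : ({z | ∃ u ∈ T, (openGraph ω).Reachable u z} : Set V).ncard + 1 ≤ j := hωL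
        omega
    · rintro ω ⟨hωN, hωR⟩
      refine ⟨fun ⟨x, hx, hxc⟩ => hωN x hx (show (openGraph ω).Reachable c x from hxc.symm), ?_⟩
      change (openCluster ω c).ncard ≤ j
      rw [← card_filter_univ_openConn]
      exact hωR
  have e1 : μ.real (L ∩ N) + μ.real (L \ N) = μ.real L := measureReal_inter_add_sdiff (μ := μ) (hmeas N)
  set R : Set (BondConfig V) := {ω |
        ((¬ ∃ u ∈ T, (openGraph ω).Reachable u c) ∧ (openCluster ω c).ncard ≤ j) ∨
        ((∃ u ∈ T, (openGraph ω).Reachable u c) ∧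
          ({z | ∃ u ∈ T, (openGraph ω).Reachable u z} : Set V).ncard + 1 ≤ j)} with hR
  have e2 : μ.real (R ∩ N) + μ.real (R \ N) = μ.real R := measureReal_inter_add_sdiff (μ := μ) (hmeas N)
  have hA2 : N ∩ Rc ⊆ R ∩ N := by
    rintro ω ⟨hωN, hωR⟩
    exact ⟨Or.inl ⟨hωN, hωR⟩, hωN⟩
  have hA3 : L \ N ⊆ R \ N := by
    rintro ω ⟨hωL, hωN⟩
    refine ⟨Or.inr ⟨?_, hωL⟩, hωN⟩
    simpa [hN] using hωN
  have := measureReal_mono (μ := μ) hA2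
  have := measureReal_mono (μ := μ) hA3
  linarith

end Measure



/-! #### Clusters under the star `σ_B` of `0`, read in `G ∖ {0}` -/

/-- Under `σ_B`, a vertex `v ≠ 0` is joined to `0` iff it is joined off `0` to a vertex of `B ∖ {0}`.
[cite: KozmaNitzan2024, Lemma 5 (p. 13)] -/
theorem reachable_center_iff_of_mem_starEvent {ω : BondConfig V} {o : V} {B : Set V}
    (hσ : ω ∈ starEvent o B) {v : V} (hv : v ≠ o) :
    (openGraph ω).Reachable o v ↔ ∃ u ∈ B, u ≠ o ∧ ω ∈ openConnIn ({o}ᶜ : Set V) u v := by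
  constructor
  · rintro ⟨p⟩
    exact (walk_decomp hσ p hv).2 rfl
  · rintro ⟨u, huB, huo, huv⟩
    have hou : s(o, u) ∈ ω := ((mem_starEvent_iff o B ω).1 hσ u huo).2 huB
    have hadj : (openGraph ω).Adj o u := (openGraph_adj ω o u).2 ⟨hou, huo.symm⟩
    exact hadj.reachable.trans (reachable_of_openConnIn huv)

/-- Under `σ_B`, two vertices `v, z ≠ 0` are joined iff they are joined off `0`, or `v` is joined off
`0` to `B ∖ {0}` and `B ∖ {0}` is joined off `0` to `z`. [cite: KozmaNitzan2024, Lemma 5 (p. 13)] -/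
theorem reachable_iff_of_mem_starEvent {ω : BondConfig V} {o : V} {B : Set V}
    (hσ : ω ∈ starEvent o B) {v z : V} (hv : v ≠ o) (hz : z ≠ o) :
    (openGraph ω).Reachable v z ↔ ω ∈ openConnIn ({o}ᶜ : Set V) v z ∨
      ((∃ u ∈ B, u ≠ o ∧ ω ∈ openConnIn ({o}ᶜ : Set V) v u) ∧
        ∃ u' ∈ B, u' ≠ o ∧ ω ∈ openConnIn ({o}ᶜ : Set V) u' z) := by
  constructor
  · rintro ⟨p⟩
    exact (walk_decomp hσ p hz).1 hv
  · rintro (h | ⟨⟨u, huB, huo, hvu⟩, ⟨u', hu'B, hu'o, hu'z⟩⟩)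
    · exact reachable_of_openConnIn h
    · have h1 : (openGraph ω).Reachable o u :=
        (reachable_center_iff_of_mem_starEvent hσ huo).2 ⟨u, huB, huo, openConnIn_rfl
          (mem_compl_singleton_iff.2 huo) ω⟩
      have h2 : (openGraph ω).Reachable o z :=
        (reachable_center_iff_of_mem_starEvent hσ hz).2 ⟨u', hu'B, hu'o, hu'z⟩
      exact ((reachable_of_openConnIn hvu).trans h1.symm).trans h2

/-- Under `σ_B`, the cluster of `0` is `{0} ∪ C_{G∖0}(B ∖ {0})`. [cite: KozmaNitzan2024, Lemma 5 (p. 13)] -/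
theorem openCluster_center_eq_of_mem_starEvent {ω : BondConfig V} {o : V} {B : Set V}
    (hσ : ω ∈ starEvent o B) :
    openCluster ω o = insert o {y | ∃ u ∈ B, u ≠ o ∧ ω ∈ openConnIn ({o}ᶜ : Set V) u y} := by
  ext y
  by_cases hy : y = o
  · subst hy
    simp only [mem_insert_iff, true_or, iff_true]
    exact mem_openCluster_self ω y
  · rw [mem_insert_iff, mem_setOf_eq]
    change (openGraph ω).Reachable o y ↔ _
    rw [reachable_center_iff_of_mem_starEvent hσ hy]
    simp only [hy, false_or]

/-- Under `σ_B`, the cluster of a vertex `v ≠ 0` not joined off `0` to `B ∖ {0}` is its cluster in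
`G ∖ {0}`. [cite: KozmaNitzan2024, Lemma 5 (p. 13)] -/
theorem openCluster_eq_of_mem_starEvent_of_not {ω : BondConfig V} {o : V} {B : Set V}
    (hσ : ω ∈ starEvent o B) {v : V} (hv : v ≠ o)
    (hn : ∀ u ∈ B, u ≠ o → ω ∉ openConnIn ({o}ᶜ : Set V) v u) :
    openCluster ω v = {y | ω ∈ openConnIn ({o}ᶜ : Set V) v y} := by
  ext y
  rw [mem_setOf_eq]
  change (openGraph ω).Reachable v y ↔ _
  by_cases hy : y = o
  · subst hy
    constructor
    · intro h
      obtain ⟨u, huB, huo, ⟨h1, h2, hr⟩⟩ := (reachable_center_iff_of_mem_starEvent hσ hv).1 h.symm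
      exact absurd ⟨h2, h1, hr.symm⟩ (hn u huB huo)
    · rintro ⟨_, h, _⟩
      exact absurd rfl (mem_compl_singleton_iff.1 h)
  · rw [reachable_iff_of_mem_starEvent hσ hv hy]
    constructor
    · rintro (h | ⟨⟨u, huB, huo, hvu⟩, _⟩)
      · exact h
      · exact absurd hvu (hn u huB huo)
    · exact fun h => Or.inl h

/-- Under `σ_B`, the cluster of a vertex `v ≠ 0` joined off `0` to `B ∖ {0}` is `{0} ∪ C_{G∖0}(B ∖ {0})`.
[cite: KozmaNitzan2024, Lemma 5 (p. 13)] -/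
theorem openCluster_eq_of_mem_starEvent_of_conn {ω : BondConfig V} {o : V} {B : Set V}
    (hσ : ω ∈ starEvent o B) {v : V} (hv : v ≠ o)
    (hc : ∃ u ∈ B, u ≠ o ∧ ω ∈ openConnIn ({o}ᶜ : Set V) v u) :
    openCluster ω v = insert o {y | ∃ u ∈ B, u ≠ o ∧ ω ∈ openConnIn ({o}ᶜ : Set V) u y} := by
  have hov : (openGraph ω).Reachable o v := by
    obtain ⟨u, huB, huo, hvu⟩ := hc
    obtain ⟨h1, h2, hr⟩ := hvu
    exact (reachable_center_iff_of_mem_starEvent hσ hv).2 ⟨u, huB, huo, ⟨h2, h1, hr.symm⟩⟩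
  rw [← openCluster_center_eq_of_mem_starEvent hσ]
  exact (openCluster_eq_of_reachable hov).symm

/-- The vertices joined off `0` to a vertex are all `≠ 0`. [folklore] -/
theorem not_mem_setOf_openConnIn_center (ω : BondConfig V) (o : V) (B : Set V) :
    o ∉ ({y | ∃ u ∈ B, u ≠ o ∧ ω ∈ openConnIn ({o}ᶜ : Set V) u y} : Set V) := by
  rintro ⟨u, -, -, -, h, -⟩
  exact absurd rfl (mem_compl_singleton_iff.1 h)


/-! #### Reading the clusters under `σ_T` on the restricted configuration -/

/-- The vertices joined off `0` to `T ∖ {0}` are the image of the vertices joined, in the restricted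
configuration on `{0}ᶜ`, to the vertices of `{0}ᶜ` lying in `T`. [folklore] -/
theorem image_setOf_exists_reachable_restrictConfig (o : V) (ω : BondConfig V) (T : Finset V)
    [Fintype (({o}ᶜ : Set V))] :
    Subtype.val '' {y' | ∃ u ∈ (Finset.univ.filter fun u : ({o}ᶜ : Set V) => (u : V) ∈ T),
        (openGraph (restrictConfig (Subtype.val : ({o}ᶜ : Set V) → V) ω)).Reachable u y'} =
      {y | ∃ u ∈ (T : Set V), u ≠ o ∧ ω ∈ openConnIn ({o}ᶜ : Set V) u y} := by
  ext y
  constructor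
  · rintro ⟨y', ⟨u, hu, huy⟩, rfl⟩
    refine ⟨u, Finset.mem_coe.2 (Finset.mem_filter.1 hu).2, mem_compl_singleton_iff.1 u.2, ?_⟩
    exact (reachable_restrictConfig_val_iff _ ω u y').1 huy
  · rintro ⟨u, huT, huo, huy⟩
    have hyS : y ∈ ({o}ᶜ : Set V) := by
      obtain ⟨_, hy2, _⟩ := huy
      exact hy2
    have huS : u ∈ ({o}ᶜ : Set V) := mem_compl_singleton_iff.2 huo
    refine ⟨⟨y, hyS⟩, ⟨⟨u, huS⟩, Finset.mem_filter.2 ⟨Finset.mem_univ _, Finset.mem_coe.1 huT⟩,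
      (reachable_restrictConfig_val_iff _ ω ⟨u, huS⟩ ⟨y, hyS⟩).2 huy⟩, rfl⟩

/-- A vertex `v ≠ 0` is joined, in the restricted configuration, to a vertex of `{0}ᶜ` lying in `T`
iff it is joined off `0` to `T ∖ {0}`. [folklore] -/
theorem exists_reachable_restrictConfig_iff (o : V) (ω : BondConfig V) (T : Finset V)
    [Fintype (({o}ᶜ : Set V))] (v : ({o}ᶜ : Set V)) :
    (∃ u ∈ (Finset.univ.filter fun u : ({o}ᶜ : Set V) => (u : V) ∈ T),
        (openGraph (restrictConfig (Subtype.val : ({o}ᶜ : Set V) → V) ω)).Reachable u v) ↔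
      ∃ u ∈ (T : Set V), u ≠ o ∧ ω ∈ openConnIn ({o}ᶜ : Set V) v u := by
  constructor
  · rintro ⟨u, hu, huv⟩
    refine ⟨u, Finset.mem_coe.2 (Finset.mem_filter.1 hu).2, mem_compl_singleton_iff.1 u.2, ?_⟩
    obtain ⟨h1, h2, hr⟩ := (reachable_restrictConfig_val_iff _ ω u v).1 huv
    exact ⟨h2, h1, hr.symm⟩
  · rintro ⟨u, huT, huo, ⟨h1, h2, hr⟩⟩
    have huS : u ∈ ({o}ᶜ : Set V) := mem_compl_singleton_iff.2 huo
    exact ⟨⟨u, huS⟩, Finset.mem_filter.2 ⟨Finset.mem_univ _, Finset.mem_coe.1 huT⟩,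
      (reachable_restrictConfig_val_iff _ ω ⟨u, huS⟩ v).2 ⟨h2, h1, hr.symm⟩⟩

/-- `|C_{G∖0}(v)|` read on the restricted configuration. [folklore] -/
theorem ncard_openCluster_restrictConfig (o : V) (ω : BondConfig V) (v : ({o}ᶜ : Set V)) :
    (openCluster (restrictConfig (Subtype.val : ({o}ᶜ : Set V) → V) ω) v).ncard =
      ({y | ω ∈ openConnIn ({o}ᶜ : Set V) (v : V) y} : Set V).ncard := by
  rw [← image_openCluster_restrictConfig, Set.ncard_image_of_injective _ Subtype.val_injective]

/-- **The cluster size of `v ≠ 0` under `σ_T`, read in `G ∖ {0}`**: `|C(v)| ≤ j` iff either `v` is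
not joined off `0` to `T` and `|C_{G∖0}(v)| ≤ j`, or it is and `|C_{G∖0}(T)| + 1 ≤ j`.
[cite: KozmaNitzan2024, Lemma 5 (p. 13) — the coupling `G ↔ G ∖ {0}` under `σ_B`] -/
theorem ncard_openCluster_le_iff_of_mem_starEvent [Finite V] {ω : BondConfig V} {o : V}
    {T : Finset V} [Fintype (({o}ᶜ : Set V))] (hσ : ω ∈ starEvent o (T : Set V)) (v : ({o}ᶜ : Set V)) (j : ℕ) :
    (openCluster ω (v : V)).ncard ≤ j ↔
      ((¬ ∃ u ∈ (Finset.univ.filter fun u : ({o}ᶜ : Set V) => (u : V) ∈ T),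
          (openGraph (restrictConfig (Subtype.val : ({o}ᶜ : Set V) → V) ω)).Reachable u v) ∧
        (openCluster (restrictConfig (Subtype.val : ({o}ᶜ : Set V) → V) ω) v).ncard ≤ j) ∨
      ((∃ u ∈ (Finset.univ.filter fun u : ({o}ᶜ : Set V) => (u : V) ∈ T),
          (openGraph (restrictConfig (Subtype.val : ({o}ᶜ : Set V) → V) ω)).Reachable u v) ∧
        ({z | ∃ u ∈ (Finset.univ.filter fun u : ({o}ᶜ : Set V) => (u : V) ∈ T),
          (openGraph (restrictConfig (Subtype.val : ({o}ᶜ : Set V) → V) ω)).Reachable u z} :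
            Set ({o}ᶜ : Set V)).ncard + 1 ≤ j) := by
  have hvo : (v : V) ≠ o := mem_compl_singleton_iff.1 v.2
  rw [exists_reachable_restrictConfig_iff, ncard_openCluster_restrictConfig,
    ← Set.ncard_image_of_injective _ Subtype.val_injective,
    image_setOf_exists_reachable_restrictConfig]
  by_cases hc : ∃ u ∈ (T : Set V), u ≠ o ∧ ω ∈ openConnIn ({o}ᶜ : Set V) (v : V) u
  · rw [openCluster_eq_of_mem_starEvent_of_conn hσ hvo hc,
      Set.ncard_insert_of_notMem (not_mem_setOf_openConnIn_center ω o _) (Set.toFinite _)]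
    simp only [hc, not_true_eq_false, false_and, true_and, false_or]
  · have hn : ∀ u ∈ (T : Set V), u ≠ o → ω ∉ openConnIn ({o}ᶜ : Set V) (v : V) u :=
      fun u hu huo h => hc ⟨u, hu, huo, h⟩
    rw [openCluster_eq_of_mem_starEvent_of_not hσ hvo hn]
    simp only [hc, not_false_eq_true, true_and, false_and, or_false]


section CaseLemmas

variable [Fintype V]

/-- **Case A of the pendant-star inequality, one star at a time.**  If `a₀` is a champion of `A`
(`P(|C(a)| ≤ 3) ≤ P(|C(a₀)| ≤ 3)` for all `a ∈ A`), then for every `T`,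
`P(T = {a'}, a' ∈ A ∖ a₀, C(a') = {a'}) ≤ P(|C(a₀)| ≤ 3, a₀ ↮ T, T ↔ A ∖ a₀)` (restricted championship
of `a₀` over `a'` on `{a₀ ↮ a'}`). [cite: KozmaNitzan2024, Thm. 9 (p. 32) — proof step, this file] -/
theorem pendantStar_caseA_star (w : Sym2 V → unitInterval) (A T : Finset V) (a₀ : V)
    (hA : ∀ a ∈ A, (prodBernoulli w).real {ω | (openCluster ω a).ncard ≤ 3} ≤
      (prodBernoulli w).real {ω | (openCluster ω a₀).ncard ≤ 3}) :
    (prodBernoulli w).real {ω | ∃ a' ∈ A, a' ≠ a₀ ∧ T = {a'} ∧ openCluster ω a' = {a'}} ≤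
      (prodBernoulli w).real {ω | (openCluster ω a₀).ncard ≤ 3 ∧
        (¬ ∃ u ∈ T, (openGraph ω).Reachable u a₀) ∧
        ∃ a' ∈ A, a' ≠ a₀ ∧ ∃ u ∈ T, (openGraph ω).Reachable u a'} := by
  set μ := prodBernoulli w with hμ
  by_cases hT : ∃ a' ∈ A, a' ≠ a₀ ∧ T = {a'}
  · obtain ⟨a', ha'A, ha'a₀, rfl⟩ := hT
    have h1 : {ω : BondConfig V | ∃ a'' ∈ A, a'' ≠ a₀ ∧ ({a'} : Finset V) = {a''} ∧
        openCluster ω a'' = {a''}} ⊆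
        {ω | (openCluster ω a').ncard ≤ 3} ∩ (openConn a' a₀)ᶜ := by
      rintro ω ⟨a'', -, -, hTa, hC⟩
      have haa : a'' = a' := (Finset.singleton_injective hTa).symm
      subst haa
      refine ⟨?_, fun h => ?_⟩
      · change (openCluster ω a'').ncard ≤ 3
        rw [hC, ncard_singleton]
        omega
      · have : a₀ ∈ openCluster ω a'' := h
        rw [hC, mem_singleton_iff] at this
        exact ha'a₀ this.symm
    have h2 := real_inter_compl_openConn_le_of_le w a' a₀ 3 (hA a' ha'A)
    have h3 : {ω : BondConfig V | (openCluster ω a₀).ncard ≤ 3} ∩ (openConn a' a₀)ᶜ ⊆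
        {ω | (openCluster ω a₀).ncard ≤ 3 ∧
          (¬ ∃ u ∈ ({a'} : Finset V), (openGraph ω).Reachable u a₀) ∧
          ∃ a'' ∈ A, a'' ≠ a₀ ∧ ∃ u ∈ ({a'} : Finset V), (openGraph ω).Reachable u a''} := by
      rintro ω ⟨hR, hD⟩
      refine ⟨hR, ?_, ⟨a', ha'A, ha'a₀, a', Finset.mem_singleton_self a', SimpleGraph.Reachable.refl a'⟩⟩
      rintro ⟨u, hu, hua⟩
      rw [Finset.mem_singleton] at hu
      subst hu
      exact hD hua
    exact (measureReal_mono h1).trans (h2.trans (measureReal_mono h3))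
  · have h0 : {ω : BondConfig V | ∃ a' ∈ A, a' ≠ a₀ ∧ T = {a'} ∧ openCluster ω a' = {a'}} = ∅ := by
      ext ω
      simp only [mem_setOf_eq, mem_empty_iff_false, iff_false, not_exists, not_and]
      exact fun a' ha' hne hTa _ => hT ⟨a', ha', hne, hTa⟩
    rw [h0, measureReal_empty]
    exact measureReal_nonneg

/-- **Case B of the pendant-star inequality, one star at a time.**  If `i ≠ a₀`, `i, a₀ ∈ A` and `i`
is a champion of `A` (`P(|C(a)| ≤ 3) ≤ P(|C(i)| ≤ 3)` for all `a ∈ A`), then for every `T`, with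
`C(T)` the set of vertices joined to `T` and, for a vertex `v`, `S_v(T)` the event
"(`v ↮ T` and `|C(v)| ≤ 3`) or (`v ↔ T` and `|C(T)| + 1 ≤ 3`)" (smallness of `v`'s cluster after a new
vertex is glued to `T`):
`P(T = {a'}, a' ∈ A ∖ a₀, C(a') = {a'}) + P(S_{a₀}(T)) ≤ P(|C(a₀)| ≤ 3, a₀ ↮ T, T ↔ A ∖ a₀) + P(S_i(T))`.
Proof: `T = ∅`: championship; a relay in `T`: Theorem A (`real_glued_le_of_lonelier`); `T ≠ ∅`
without relays: the transfer `real_inter_notConn_le_of_le` and `|C(T)| ≤ 2`.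
[cite: KozmaNitzan2024, Thm. 9 (p. 32) — proof step, this file; VandenbergHaggstromKahn2005, Thm. 1.5] -/
theorem pendantStar_caseB_star (w : Sym2 V → unitInterval) (A T : Finset V) {a₀ i : V}
    (ha₀ : a₀ ∈ A) (hiA : i ∈ A) (hia₀ : i ≠ a₀)
    (hi : ∀ a ∈ A, (prodBernoulli w).real {ω | (openCluster ω a).ncard ≤ 3} ≤
      (prodBernoulli w).real {ω | (openCluster ω i).ncard ≤ 3}) :
    (prodBernoulli w).real {ω | ∃ a' ∈ A, a' ≠ a₀ ∧ T = {a'} ∧ openCluster ω a' = {a'}} +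
      (prodBernoulli w).real {ω |
        ((¬ ∃ u ∈ T, (openGraph ω).Reachable u a₀) ∧ (openCluster ω a₀).ncard ≤ 3) ∨
        ((∃ u ∈ T, (openGraph ω).Reachable u a₀) ∧
          ({z | ∃ u ∈ T, (openGraph ω).Reachable u z} : Set V).ncard + 1 ≤ 3)} ≤
    (prodBernoulli w).real {ω | (openCluster ω a₀).ncard ≤ 3 ∧
        (¬ ∃ u ∈ T, (openGraph ω).Reachable u a₀) ∧
        ∃ a' ∈ A, a' ≠ a₀ ∧ ∃ u ∈ T, (openGraph ω).Reachable u a'} +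
      (prodBernoulli w).real {ω |
        ((¬ ∃ u ∈ T, (openGraph ω).Reachable u i) ∧ (openCluster ω i).ncard ≤ 3) ∨
        ((∃ u ∈ T, (openGraph ω).Reachable u i) ∧
          ({z | ∃ u ∈ T, (openGraph ω).Reachable u z} : Set V).ncard + 1 ≤ 3)} := by
  set μ := prodBernoulli w with hμ
  have hmeas : ∀ S : Set (BondConfig V), MeasurableSet S := fun S => MeasurableSet.of_discrete
  set CT : BondConfig V → Set V := fun ω => {z | ∃ u ∈ T, (openGraph ω).Reachable u z} with hCT
  set LT : Set (BondConfig V) := {ω | ∃ a' ∈ A, a' ≠ a₀ ∧ T = {a'} ∧ openCluster ω a' = {a'}}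
    with hLT
  set RT : Set (BondConfig V) := {ω | (openCluster ω a₀).ncard ≤ 3 ∧
        (¬ ∃ u ∈ T, (openGraph ω).Reachable u a₀) ∧
        ∃ a' ∈ A, a' ≠ a₀ ∧ ∃ u ∈ T, (openGraph ω).Reachable u a'} with hRT
  set Sa : Set (BondConfig V) := {ω |
        ((¬ ∃ u ∈ T, (openGraph ω).Reachable u a₀) ∧ (openCluster ω a₀).ncard ≤ 3) ∨
        ((∃ u ∈ T, (openGraph ω).Reachable u a₀) ∧ (CT ω).ncard + 1 ≤ 3)} with hSa
  set Si : Set (BondConfig V) := {ω |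
        ((¬ ∃ u ∈ T, (openGraph ω).Reachable u i) ∧ (openCluster ω i).ncard ≤ 3) ∨
        ((∃ u ∈ T, (openGraph ω).Reachable u i) ∧ (CT ω).ncard + 1 ≤ 3)} with hSi
  set E2 : Set (BondConfig V) := {ω | (∃ u ∈ T, (openGraph ω).Reachable u a₀) ∧
      (CT ω).ncard + 1 ≤ 3} with hE2
  set E3 : Set (BondConfig V) := {ω | (¬ ∃ u ∈ T, (openGraph ω).Reachable u a₀) ∧
      (openCluster ω a₀).ncard ≤ 3 ∧
      ¬ ∃ a' ∈ A, a' ≠ a₀ ∧ ∃ u ∈ T, (openGraph ω).Reachable u a'} with hE3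
  change μ.real LT + μ.real Sa ≤ μ.real RT + μ.real Si
  -- `S_{a₀}(T) ⊆ E2 ∪ (RT ∪ E3)`
  have hSa_sub : Sa ⊆ E2 ∪ (RT ∪ E3) := by
    rintro ω (⟨hn, hR⟩ | ⟨hc, hsmall⟩)
    · by_cases h : ∃ a' ∈ A, a' ≠ a₀ ∧ ∃ u ∈ T, (openGraph ω).Reachable u a'
      · exact Or.inr (Or.inl ⟨hR, hn, h⟩)
      · exact Or.inr (Or.inr ⟨hn, hR, h⟩)
    · exact Or.inl ⟨hc, hsmall⟩
  have hSa_le : μ.real Sa ≤ μ.real E2 + (μ.real RT + μ.real E3) :=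
    (measureReal_mono hSa_sub).trans
      ((measureReal_union_le _ _).trans (add_le_add le_rfl (measureReal_union_le _ _)))
  -- the heart: `μ(LT) + μ(E2) + μ(E3) ≤ μ(S_i(T))`
  have key : μ.real LT + μ.real E2 + μ.real E3 ≤ μ.real Si := by
    by_cases hT0 : T = ∅
    · -- the empty star: championship of `i` over `a₀`
      subst hT0
      have hL0 : LT = ∅ := by
        ext ω
        simp only [hLT, mem_setOf_eq, mem_empty_iff_false, iff_false, not_exists, not_and]
        exact fun a' _ _ h _ => Finset.singleton_ne_empty a' h.symm
      have hE20 : E2 = ∅ := by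
        ext ω
        simp only [hE2, mem_setOf_eq, mem_empty_iff_false, iff_false, not_and]
        rintro ⟨u, hu, -⟩
        simp at hu
      have hE3sub : E3 ⊆ {ω | (openCluster ω a₀).ncard ≤ 3} := fun ω ⟨_, h, _⟩ => h
      have hSisup : {ω : BondConfig V | (openCluster ω i).ncard ≤ 3} ⊆ Si := by
        intro ω h
        refine Or.inl ⟨?_, h⟩
        rintro ⟨u, hu, -⟩
        simp at hu
      rw [hL0, hE20, measureReal_empty, zero_add, zero_add]
      exact (measureReal_mono hE3sub).trans ((hi a₀ ha₀).trans (measureReal_mono hSisup))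
    by_cases hTA : ∃ y ∈ T, y ∈ A
    · -- a relay `y` in the star: Theorem A
      obtain ⟨y, hyT, hyA⟩ := hTA
      have hE30 : E3 = ∅ := by
        ext ω
        simp only [hE3, mem_setOf_eq, mem_empty_iff_false, iff_false, not_and, not_not]
        intro hn _
        by_cases hya : y = a₀
        · subst hya
          exact absurd ⟨y, hyT, SimpleGraph.Reachable.refl y⟩ hn
        · exact ⟨y, hyA, hya, y, hyT, SimpleGraph.Reachable.refl y⟩
      have hdisj : Disjoint LT E2 := by
        rw [Set.disjoint_left]
        rintro ω ⟨a', -, ha'ne, hTa, hC⟩ ⟨⟨u, hu, hua⟩, -⟩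
        rw [hTa, Finset.mem_singleton] at hu
        subst hu
        have : a₀ ∈ openCluster ω u := hua
        rw [hC, mem_singleton_iff] at this
        exact ha'ne this.symm
      have hsub : LT ∪ E2 ⊆ {ω | (CT ω).ncard + 1 ≤ 3} := by
        rintro ω (⟨a', -, -, hTa, hC⟩ | ⟨-, h⟩)
        · change (CT ω).ncard + 1 ≤ 3
          have hCT' : CT ω = openCluster ω a' := by
            ext z
            simp only [hCT, mem_setOf_eq, hTa, Finset.mem_singleton]
            constructor
            · rintro ⟨u, rfl, h⟩
              exact h
            · exact fun h => ⟨a', rfl, h⟩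
          rw [hCT', hC, ncard_singleton]
          omega
        · exact h
      have hTA' := real_glued_le_of_lonelier w T y i hyT 3 (hi y hyA)
      rw [hE30, measureReal_empty, add_zero, ← measureReal_union hdisj (hmeas E2)]
      exact (measureReal_mono hsub).trans hTA'
    · -- a nonempty star without relays: the transfer, and `|C(T)| ≤ 2` pins the configuration
      push Not at hTA
      have hL0 : LT = ∅ := by
        ext ω
        simp only [hLT, mem_setOf_eq, mem_empty_iff_false, iff_false, not_exists, not_and]
        intro a' ha' _ hTa _
        exact hTA a' (hTa ▸ Finset.mem_singleton_self a') ha'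
      have hdisj : Disjoint E2 E3 := by
        rw [Set.disjoint_left]
        rintro ω ⟨hc, -⟩ ⟨hn, -⟩
        exact hn hc
      set Ni : Set (BondConfig V) := {ω | ∀ u ∈ T, ω ∉ openConn i u} with hNi
      have hsub : E2 ∪ E3 ⊆ {ω | (openCluster ω a₀).ncard ≤ 3} ∩ Ni := by
        rintro ω (⟨⟨u, hu, hua⟩, hsmall⟩ | ⟨hn, hR, hnA⟩)
        · have hfin : (CT ω).Finite := Set.toFinite _
          have hCa : openCluster ω a₀ ⊆ CT ω := fun z hz => ⟨u, hu, hua.trans hz⟩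
          refine ⟨?_, fun u' hu' hiu' => ?_⟩
          · change (openCluster ω a₀).ncard ≤ 3
            have := Set.ncard_le_ncard hCa hfin
            omega
          · have hi_mem : i ∈ CT ω :=
              ⟨u', hu', (show (openGraph ω).Reachable i u' from hiu').symm⟩
            have ha_mem : a₀ ∈ CT ω := ⟨u, hu, hua⟩
            have hu_mem : u' ∈ CT ω := ⟨u', hu', SimpleGraph.Reachable.refl u'⟩
            have hiu : i ≠ u' := fun h => hTA u' hu' (h ▸ hiA)
            have hau : a₀ ≠ u' := fun h => hTA u' hu' (h ▸ ha₀)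
            have h3 := three_le_ncard_of_mem hi_mem ha_mem hu_mem hia₀ hiu hau
            change (CT ω).ncard + 1 ≤ 3 at hsmall
            omega
        · refine ⟨hR, fun u' hu' hiu' => hnA ⟨i, hiA, hia₀, u', hu', ?_⟩⟩
          exact (show (openGraph ω).Reachable i u' from hiu').symm
      have htr := real_inter_notConn_le_of_le w hia₀.symm T 3 (hi a₀ ha₀)
      have hsup : {ω : BondConfig V | (openCluster ω i).ncard ≤ 3} ∩ Ni ⊆ Si := by
        rintro ω ⟨hR, hN⟩
        refine Or.inl ⟨?_, hR⟩
        rintro ⟨u, hu, hui⟩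
        exact hN u hu (show ω ∈ openConn i u from hui.symm)
      rw [hL0, measureReal_empty, zero_add, ← measureReal_union hdisj (hmeas E3)]
      exact (measureReal_mono hsub).trans (htr.trans (measureReal_mono hsup))
  linarith

end CaseLemmas

/-- **Transport of the left event of the pendant-star inequality under `σ_T`.**  If `0 ∉ A`, `0 ∉ T`
and, under `σ_T`, `|C(0)| ≤ 2`, `0 ↔ A` and `0 ↮ a₀`, then on `G ∖ {0}`: `T = {a'}` for a relay
`a' ≠ a₀` whose cluster is `{a'}`. [cite: KozmaNitzan2024, Thm. 9 (p. 32) — proof step, this file] -/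
theorem pendantStar_transport_left [Finite V] {o a₀ : V} {A T : Finset V}
    [Fintype (({o}ᶜ : Set V))]
    (hoA : o ∉ A) (ha₀o : a₀ ≠ o) (hoT : o ∉ T) :
    ({ω : BondConfig V | (openCluster ω o).ncard + 1 ≤ 3} ∩
        ((⋃ a ∈ A, (openConn o a : Set (BondConfig V))) ∩ (openConn o a₀)ᶜ)) ∩
        starEvent o (T : Set V) ⊆
      starEvent o (T : Set V) ∩ restrictConfig (Subtype.val : ({o}ᶜ : Set V) → V) ⁻¹'
        {ω' | ∃ a' ∈ (Finset.univ.filter fun a : ({o}ᶜ : Set V) => (a : V) ∈ A),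
          a' ≠ ⟨a₀, mem_compl_singleton_iff.2 ha₀o⟩ ∧
          (Finset.univ.filter fun u : ({o}ᶜ : Set V) => (u : V) ∈ T) = {a'} ∧
            openCluster ω' a' = {a'}} := by
  rintro ω ⟨⟨hsmall, hE, hna₀⟩, hσ⟩
  refine ⟨hσ, ?_⟩
  rw [mem_preimage]
  obtain ⟨a, haA, hoa⟩ := mem_iUnion₂.1 hE
  have hao : a ≠ o := fun h => hoA (h ▸ haA)
  have hoa' : (openGraph ω).Reachable o a := hoa
  obtain ⟨u, huT, huo, hua⟩ := (reachable_center_iff_of_mem_starEvent hσ hao).1 hoa'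
  set CT : Set V := {y | ∃ u ∈ (T : Set V), u ≠ o ∧ ω ∈ openConnIn ({o}ᶜ : Set V) u y} with hCT
  have hC0 : openCluster ω o = insert o CT := openCluster_center_eq_of_mem_starEvent hσ
  have hCTfin : CT.Finite := Set.toFinite _
  have hCT1 : CT.ncard ≤ 1 := by
    have h1 : (insert o CT).ncard + 1 ≤ 3 := by
      rw [← hC0]
      exact hsmall
    have hnot : o ∉ CT := not_mem_setOf_openConnIn_center ω o _
    rw [Set.ncard_insert_of_notMem hnot hCTfin] at h1
    omega
  have huniq := (Set.ncard_le_one hCTfin).1 hCT1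
  have haCT : a ∈ CT := ⟨u, huT, huo, hua⟩
  have hmemT : ∀ t ∈ T, t = a := by
    intro t ht
    have hto : t ≠ o := fun h => hoT (h ▸ ht)
    exact huniq t ⟨t, Finset.mem_coe.2 ht, hto, openConnIn_rfl (mem_compl_singleton_iff.2 hto) ω⟩
      a haCT
  have haT : a ∈ T := by
    have := hmemT u (Finset.mem_coe.1 huT)
    exact this ▸ Finset.mem_coe.1 huT
  have haa₀ : a ≠ a₀ := by
    rintro rfl
    exact hna₀ hoa
  refine ⟨⟨a, mem_compl_singleton_iff.2 hao⟩, Finset.mem_filter.2 ⟨Finset.mem_univ _, haA⟩,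
    fun h => haa₀ (congrArg Subtype.val h), ?_, ?_⟩
  · ext z
    simp only [Finset.mem_filter, Finset.mem_univ, true_and, Finset.mem_singleton]
    constructor
    · intro hz
      exact Subtype.ext (hmemT z hz)
    · rintro rfl
      exact haT
  · ext z
    rw [mem_singleton_iff]
    change (openGraph (restrictConfig Subtype.val ω)).Reachable _ z ↔ _
    constructor
    · intro hz
      have hz' := (reachable_restrictConfig_val_iff _ ω ⟨a, mem_compl_singleton_iff.2 hao⟩ z).1 hz
      have hzCT : (z : V) ∈ CT := ⟨a, Finset.mem_coe.2 haT, hao, hz'⟩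
      exact Subtype.ext (huniq z hzCT a haCT)
    · rintro rfl
      exact SimpleGraph.Reachable.refl _

/-- **Transport of the right event of the pendant-star inequality under `σ_T`.**  If, on `G ∖ {0}`,
`|C(a₀)| ≤ 3`, `a₀ ↮ T` and `T ↔ A ∖ a₀`, then under `σ_T`: `|C(a₀)| ≤ 3`, `0 ↔ A` and `0 ↮ a₀`.
[cite: KozmaNitzan2024, Thm. 9 (p. 32) — proof step, this file] -/
theorem pendantStar_transport_right {o a₀ : V} {A T : Finset V}
    [Fintype (({o}ᶜ : Set V))] (ha₀o : a₀ ≠ o) :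
    starEvent o (T : Set V) ∩ restrictConfig (Subtype.val : ({o}ᶜ : Set V) → V) ⁻¹'
        {ω' | (openCluster ω' ⟨a₀, mem_compl_singleton_iff.2 ha₀o⟩).ncard ≤ 3 ∧
          (¬ ∃ u ∈ (Finset.univ.filter fun u : ({o}ᶜ : Set V) => (u : V) ∈ T),
            (openGraph ω').Reachable u ⟨a₀, mem_compl_singleton_iff.2 ha₀o⟩) ∧
          ∃ a' ∈ (Finset.univ.filter fun a : ({o}ᶜ : Set V) => (a : V) ∈ A),
            a' ≠ ⟨a₀, mem_compl_singleton_iff.2 ha₀o⟩ ∧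
            ∃ u ∈ (Finset.univ.filter fun u : ({o}ᶜ : Set V) => (u : V) ∈ T),
              (openGraph ω').Reachable u a'} ⊆
      ({ω : BondConfig V | (openCluster ω a₀).ncard ≤ 3} ∩
        ((⋃ a ∈ A, (openConn o a : Set (BondConfig V))) ∩ (openConn o a₀)ᶜ)) ∩
        starEvent o (T : Set V) := by
  rintro ω ⟨hσ, hω⟩
  rw [mem_preimage] at hω
  obtain ⟨hR, hn', a', ha', -, u', hu'T, hua'⟩ := hω
  set a₀' : ({o}ᶜ : Set V) := ⟨a₀, mem_compl_singleton_iff.2 ha₀o⟩ with ha₀'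
  have hn : ∀ u ∈ (T : Set V), u ≠ o → ω ∉ openConnIn ({o}ᶜ : Set V) a₀ u :=
    fun u hu huo h => hn' ((exists_reachable_restrictConfig_iff o ω T a₀').2 ⟨u, hu, huo, h⟩)
  refine ⟨⟨?_, ?_, ?_⟩, hσ⟩
  · change (openCluster ω a₀).ncard ≤ 3
    rw [openCluster_eq_of_mem_starEvent_of_not hσ ha₀o hn, ← ncard_openCluster_restrictConfig o ω a₀']
    exact hR
  · have ha'A : ((a' : ({o}ᶜ : Set V)) : V) ∈ A := (Finset.mem_filter.1 ha').2
    refine mem_iUnion₂.2 ⟨(a' : V), ha'A, ?_⟩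
    change (openGraph ω).Reachable o a'
    refine (reachable_center_iff_of_mem_starEvent hσ (mem_compl_singleton_iff.1 a'.2)).2
      ⟨u', Finset.mem_coe.2 (Finset.mem_filter.1 hu'T).2, mem_compl_singleton_iff.1 u'.2, ?_⟩
    exact (reachable_restrictConfig_val_iff _ ω u' a').1 hua'
  · intro h
    have h' : (openGraph ω).Reachable o a₀ := h
    obtain ⟨u, huT, huo, ⟨h1, h2, hr⟩⟩ := (reachable_center_iff_of_mem_starEvent hσ ha₀o).1 h'
    exact hn u huT huo ⟨h2, h1, hr.symm⟩

/-- **Transport of a cluster-size event under `σ_T`** (set form of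
`ncard_openCluster_le_iff_of_mem_starEvent`). [cite: KozmaNitzan2024, Lemma 5 (p. 13)] -/
theorem setOf_ncard_le_inter_starEvent_eq [Finite V] {o : V} (T : Finset V)
    [Fintype (({o}ᶜ : Set V))]
    (v : ({o}ᶜ : Set V)) (j : ℕ) :
    {ω : BondConfig V | (openCluster ω (v : V)).ncard ≤ j} ∩ starEvent o (T : Set V) =
      starEvent o (T : Set V) ∩ restrictConfig (Subtype.val : ({o}ᶜ : Set V) → V) ⁻¹'
        {ω' | ((¬ ∃ u ∈ (Finset.univ.filter fun u : ({o}ᶜ : Set V) => (u : V) ∈ T),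
            (openGraph ω').Reachable u v) ∧ (openCluster ω' v).ncard ≤ j) ∨
          ((∃ u ∈ (Finset.univ.filter fun u : ({o}ᶜ : Set V) => (u : V) ∈ T),
            (openGraph ω').Reachable u v) ∧
            ({z | ∃ u ∈ (Finset.univ.filter fun u : ({o}ᶜ : Set V) => (u : V) ∈ T),
              (openGraph ω').Reachable u z} : Set ({o}ᶜ : Set V)).ncard + 1 ≤ j)} := by
  ext ω
  simp only [mem_inter_iff, mem_preimage, mem_setOf_eq]
  constructor
  · rintro ⟨h, hσ⟩
    exact ⟨hσ, (ncard_openCluster_le_iff_of_mem_starEvent hσ v j).1 h⟩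
  · rintro ⟨hσ, h⟩
    exact ⟨(ncard_openCluster_le_iff_of_mem_starEvent hσ v j).2 h, hσ⟩

end KNPreFKG

section PendantStar

variable [Fintype V]

open KNPreFKG in
/-- **The pendant-star inequality** (the case `B = {x}`, `x ∉ A`, of the star decomposition for
Theorem 9 at `k = 4`, read on `G ∖ {0}` with `x` renamed `0`).  If `0 ∉ A`, `a₀ ∈ A` and `a₀` is a
champion of `A` (`P(|C(a)| ≤ 3) ≤ P(|C(a₀)| ≤ 3)` for all `a ∈ A`), then
`P(|C(0)| ≤ 2, 0 ↔ A, 0 ↮ a₀) ≤ P(|C(a₀)| ≤ 3, 0 ↔ A, 0 ↮ a₀)`.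
Proof: decompose along the stars `σ_T` of `0` (`real_eq_sum_inter_starEvent`) and read each term on
`G ∖ {0}` (`real_starEvent_inter_preimage`, the transports above); with `i` a champion of `A` in
`G ∖ {0}`: if `a₀` is one too, every star term is dominated (`pendantStar_caseA_star`); otherwise each
star term is dominated up to the same star term of `P(|C(a₀)| ≤ 3) − P(|C(i)| ≤ 3) ≥ 0`
(`pendantStar_caseB_star`). [cite: KozmaNitzan2024, Thm. 9 (p. 32) — proof step, this file] -/
theorem pendantStar_le (w : Sym2 V → unitInterval) (A : Finset V) (o a₀ : V) (hoA : o ∉ A)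
    (ha₀ : a₀ ∈ A)
    (hchamp : ∀ a ∈ A, (prodBernoulli w).real {ω | (openCluster ω a).ncard ≤ 3} ≤
      (prodBernoulli w).real {ω | (openCluster ω a₀).ncard ≤ 3}) :
    (prodBernoulli w).real ({ω : BondConfig V | (openCluster ω o).ncard + 1 ≤ 3} ∩
        ((⋃ a ∈ A, (openConn o a : Set (BondConfig V))) ∩ (openConn o a₀)ᶜ)) ≤
      (prodBernoulli w).real ({ω : BondConfig V | (openCluster ω a₀).ncard ≤ 3} ∩
        ((⋃ a ∈ A, (openConn o a : Set (BondConfig V))) ∩ (openConn o a₀)ᶜ)) := by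
  set μ := prodBernoulli w with hμ
  set L : Set (BondConfig V) := {ω : BondConfig V | (openCluster ω o).ncard + 1 ≤ 3} ∩
        ((⋃ a ∈ A, (openConn o a : Set (BondConfig V))) ∩ (openConn o a₀)ᶜ) with hL
  set R : Set (BondConfig V) := {ω : BondConfig V | (openCluster ω a₀).ncard ≤ 3} ∩
        ((⋃ a ∈ A, (openConn o a : Set (BondConfig V))) ∩ (openConn o a₀)ᶜ) with hR
  -- the graph `G ∖ {0}`: weights restricted to the pairs inside `{0}ᶜ`
  set w' : Sym2 ({o}ᶜ : Set V) → unitInterval :=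
    w ∘ Sym2.map (Subtype.val : ({o}ᶜ : Set V) → V) with hw'
  set μ' := prodBernoulli w' with hμ'
  have ha₀o : a₀ ≠ o := fun h => hoA (h ▸ ha₀)
  set a₀' : ({o}ᶜ : Set V) := ⟨a₀, mem_compl_singleton_iff.2 ha₀o⟩ with ha₀'
  set AS : Finset ({o}ᶜ : Set V) := Finset.univ.filter fun a : ({o}ᶜ : Set V) => (a : V) ∈ A
    with hAS
  have ha₀'A : a₀' ∈ AS := Finset.mem_filter.2 ⟨Finset.mem_univ _, ha₀⟩
  -- a champion `i` of `A` in `G ∖ {0}`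
  obtain ⟨i', hi'A, himax⟩ := AS.exists_max_image
    (fun a : ({o}ᶜ : Set V) => μ'.real {ω' | (openCluster ω' a).ncard ≤ 3}) ⟨a₀', ha₀'A⟩
  have hi'Amem : ((i' : ({o}ᶜ : Set V)) : V) ∈ A := (Finset.mem_filter.1 hi'A).2
  -- the stars of `0`
  set U : Finset V := Finset.univ.erase o with hU
  have hoU : o ∉ U := fun h => (Finset.mem_erase.1 h).1 rfl
  have hisoU : ∀ u, u ≠ o → u ∉ U → w s(o, u) = 0 :=
    fun u huo huU => absurd (Finset.mem_erase.2 ⟨huo, Finset.mem_univ u⟩) huU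
  have hoT : ∀ T ∈ U.powerset, o ∉ T := fun T hT h => hoU (Finset.mem_powerset.1 hT h)
  -- per-star transports
  have tL : ∀ T ∈ U.powerset, μ.real (L ∩ starEvent o ↑T) ≤ μ.real (starEvent o ↑T) *
      μ'.real {ω' | ∃ a' ∈ AS, a' ≠ a₀' ∧
        (Finset.univ.filter fun u : ({o}ᶜ : Set V) => (u : V) ∈ T) = {a'} ∧
          openCluster ω' a' = {a'}} := by
    intro T hT
    rw [hμ', hw', ← real_preimage_restrictConfig_val, ← real_starEvent_inter_preimage]
    exact measureReal_mono (pendantStar_transport_left hoA ha₀o (hoT T hT))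
  have tR : ∀ T ∈ U.powerset, μ.real (starEvent o ↑T) *
      μ'.real {ω' | (openCluster ω' a₀').ncard ≤ 3 ∧
          (¬ ∃ u ∈ (Finset.univ.filter fun u : ({o}ᶜ : Set V) => (u : V) ∈ T),
            (openGraph ω').Reachable u a₀') ∧
          ∃ a' ∈ AS, a' ≠ a₀' ∧ ∃ u ∈ (Finset.univ.filter fun u : ({o}ᶜ : Set V) => (u : V) ∈ T),
              (openGraph ω').Reachable u a'} ≤ μ.real (R ∩ starEvent o ↑T) := by
    intro T hT
    rw [hμ', hw', ← real_preimage_restrictConfig_val, ← real_starEvent_inter_preimage]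
    exact measureReal_mono (pendantStar_transport_right ha₀o)
  have tS : ∀ T ∈ U.powerset, ∀ v : ({o}ᶜ : Set V),
      μ.real ({ω : BondConfig V | (openCluster ω (v : V)).ncard ≤ 3} ∩ starEvent o ↑T) =
        μ.real (starEvent o ↑T) * μ'.real
          {ω' | ((¬ ∃ u ∈ (Finset.univ.filter fun u : ({o}ᶜ : Set V) => (u : V) ∈ T),
              (openGraph ω').Reachable u v) ∧ (openCluster ω' v).ncard ≤ 3) ∨
            ((∃ u ∈ (Finset.univ.filter fun u : ({o}ᶜ : Set V) => (u : V) ∈ T),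
              (openGraph ω').Reachable u v) ∧
              ({z | ∃ u ∈ (Finset.univ.filter fun u : ({o}ᶜ : Set V) => (u : V) ∈ T),
                (openGraph ω').Reachable u z} : Set ({o}ᶜ : Set V)).ncard + 1 ≤ 3)} := by
    intro T _ v
    rw [hμ', hw', ← real_preimage_restrictConfig_val, ← real_starEvent_inter_preimage,
      setOf_ncard_le_inter_starEvent_eq]
  rw [real_eq_sum_inter_starEvent w U o hoU hisoU L, real_eq_sum_inter_starEvent w U o hoU hisoU R]
  by_cases hcase : μ'.real {ω' | (openCluster ω' i').ncard ≤ 3} ≤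
      μ'.real {ω' | (openCluster ω' a₀').ncard ≤ 3}
  · -- Case A: `a₀` is also a champion of `G ∖ {0}`
    have hchampH : ∀ a ∈ AS, μ'.real {ω' | (openCluster ω' a).ncard ≤ 3} ≤
        μ'.real {ω' | (openCluster ω' a₀').ncard ≤ 3} := fun a ha => (himax a ha).trans hcase
    refine Finset.sum_le_sum fun T hT => ?_
    have hA := pendantStar_caseA_star w' AS
      (Finset.univ.filter fun u : ({o}ᶜ : Set V) => (u : V) ∈ T) a₀' hchampH
    exact (tL T hT).trans ((mul_le_mul_of_nonneg_left hA measureReal_nonneg).trans (tR T hT))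
  · -- Case B: the champion `i ≠ a₀` of `G ∖ {0}`
    push Not at hcase
    have hia₀ : i' ≠ a₀' := by
      rintro h
      rw [h] at hcase
      exact lt_irrefl _ hcase
    set Sa : Set (BondConfig V) := {ω | (openCluster ω a₀).ncard ≤ 3} with hSa
    set Si : Set (BondConfig V) := {ω | (openCluster ω (i' : V)).ncard ≤ 3} with hSi
    have hGi : μ.real Si ≤ μ.real Sa := hchamp i' hi'Amem
    rw [real_eq_sum_inter_starEvent w U o hoU hisoU Sa,
      real_eq_sum_inter_starEvent w U o hoU hisoU Si] at hGi
    have hstar : ∀ T ∈ U.powerset, μ.real (L ∩ starEvent o ↑T) + μ.real (Sa ∩ starEvent o ↑T) ≤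
        μ.real (R ∩ starEvent o ↑T) + μ.real (Si ∩ starEvent o ↑T) := by
      intro T hT
      have hB := pendantStar_caseB_star w' AS
        (Finset.univ.filter fun u : ({o}ᶜ : Set V) => (u : V) ∈ T) ha₀'A hi'A hia₀ himax
      have hB' := mul_le_mul_of_nonneg_left hB (measureReal_nonneg : 0 ≤ μ.real (starEvent o ↑T))
      rw [mul_add, mul_add] at hB'
      have e1 := tL T hT
      have e2 := tS T hT a₀'
      have e3 := tR T hT
      have e4 := tS T hT i'
      rw [hSa, hSi]
      linarith
    have hsum := Finset.sum_le_sum hstar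
    rw [Finset.sum_add_distrib, Finset.sum_add_distrib] at hsum
    linarith

end PendantStar

section PendantStarForms

variable [Fintype V]

open KNPreFKG in
/-- **The pendant-star inequality, uncancelled form**: under the hypotheses of `pendantStar_le`,
`P(|C(0)| + 1 ≤ 3, 0 ↔ A) ≤ P(|C(a₀)| + 𝟙{0 ↔ a₀} ≤ 3, 0 ↔ A)` (on `{0 ↔ a₀}` the two clusters
coincide). [cite: KozmaNitzan2024, Thm. 9 (p. 32) — proof step, this file] -/
theorem pendantStar_le_ind (w : Sym2 V → unitInterval) (A : Finset V) (o a₀ : V) (hoA : o ∉ A)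
    (ha₀ : a₀ ∈ A)
    (hchamp : ∀ a ∈ A, (prodBernoulli w).real {ω | (openCluster ω a).ncard ≤ 3} ≤
      (prodBernoulli w).real {ω | (openCluster ω a₀).ncard ≤ 3}) :
    (prodBernoulli w).real ({ω : BondConfig V | (openCluster ω o).ncard + 1 ≤ 3} ∩
        ⋃ a ∈ A, (openConn o a : Set (BondConfig V))) ≤
      (prodBernoulli w).real ({ω : BondConfig V | (openCluster ω a₀).ncard +
          (if (openGraph ω).Reachable o a₀ then 1 else 0) ≤ 3} ∩
        ⋃ a ∈ A, (openConn o a : Set (BondConfig V))) := by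
  set μ := prodBernoulli w with hμ
  set E : Set (BondConfig V) := ⋃ a ∈ A, (openConn o a : Set (BondConfig V)) with hE
  set D : Set (BondConfig V) := openConn o a₀ with hD
  set Lf : Set (BondConfig V) := {ω : BondConfig V | (openCluster ω o).ncard + 1 ≤ 3} ∩ E with hLf
  set Rf : Set (BondConfig V) := {ω : BondConfig V | (openCluster ω a₀).ncard +
      (if (openGraph ω).Reachable o a₀ then 1 else 0) ≤ 3} ∩ E with hRf
  have hmD : MeasurableSet D := MeasurableSet.of_discrete
  have e1 : μ.real (Lf ∩ D) + μ.real (Lf \ D) = μ.real Lf := measureReal_inter_add_sdiff (μ := μ) hmD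
  have e2 : μ.real (Rf ∩ D) + μ.real (Rf \ D) = μ.real Rf := measureReal_inter_add_sdiff (μ := μ) hmD
  have hcommon : Lf ∩ D = Rf ∩ D := by
    ext ω
    simp only [hLf, hRf, hD, mem_inter_iff, mem_setOf_eq]
    constructor
    · rintro ⟨⟨h1, h2⟩, h3⟩
      have h3' : (openGraph ω).Reachable o a₀ := h3
      refine ⟨⟨?_, h2⟩, h3⟩
      rw [if_pos h3', ← openCluster_eq_of_reachable h3']
      exact h1
    · rintro ⟨⟨h1, h2⟩, h3⟩
      have h3' : (openGraph ω).Reachable o a₀ := h3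
      refine ⟨⟨?_, h2⟩, h3⟩
      rw [if_pos h3', ← openCluster_eq_of_reachable h3'] at h1
      exact h1
  have hL : Lf \ D = {ω : BondConfig V | (openCluster ω o).ncard + 1 ≤ 3} ∩ (E ∩ Dᶜ) := by
    rw [hLf, sdiff_eq, inter_assoc]
  have hR' : Rf \ D = {ω : BondConfig V | (openCluster ω a₀).ncard ≤ 3} ∩ (E ∩ Dᶜ) := by
    ext ω
    simp only [hRf, hD, mem_sdiff, mem_inter_iff, mem_setOf_eq, mem_compl_iff]
    constructor
    · rintro ⟨⟨h1, h2⟩, h3⟩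
      have h3' : ¬ (openGraph ω).Reachable o a₀ := h3
      rw [if_neg h3', add_zero] at h1
      exact ⟨h1, h2, h3⟩
    · rintro ⟨h1, h2, h3⟩
      have h3' : ¬ (openGraph ω).Reachable o a₀ := h3
      refine ⟨⟨?_, h2⟩, h3⟩
      rw [if_neg h3', add_zero]
      exact h1
  have key := pendantStar_le w A o a₀ hoA ha₀ hchamp
  rw [← hE, ← hD, ← hL, ← hR'] at key
  rw [hcommon] at e1
  linarith

open KNPreFKG in
/-- **The pendant-star inequality, threshold form** (the single Steiner star of Theorem 9 at `k = 4`,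
read on `G ∖ {0}`): under the hypotheses of `pendantStar_le`,
`P(4 ≤ |C(a₀)| + 𝟙{0 ↔ a₀}, 0 ↔ A) ≤ P(4 ≤ |C(0)| + 1, 0 ↔ A)`.
[cite: KozmaNitzan2024, Thm. 9 (p. 32) — proof step, this file] -/
theorem pendantStar_ge (w : Sym2 V → unitInterval) (A : Finset V) (o a₀ : V) (hoA : o ∉ A)
    (ha₀ : a₀ ∈ A)
    (hchamp : ∀ a ∈ A, (prodBernoulli w).real {ω | (openCluster ω a).ncard ≤ 3} ≤
      (prodBernoulli w).real {ω | (openCluster ω a₀).ncard ≤ 3}) :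
    (prodBernoulli w).real ({ω : BondConfig V | 4 ≤ (openCluster ω a₀).ncard +
          (if (openGraph ω).Reachable o a₀ then 1 else 0)} ∩
        ⋃ a ∈ A, (openConn o a : Set (BondConfig V))) ≤
      (prodBernoulli w).real ({ω : BondConfig V | 4 ≤ (openCluster ω o).ncard + 1} ∩
        ⋃ a ∈ A, (openConn o a : Set (BondConfig V))) := by
  set μ := prodBernoulli w with hμ
  set E : Set (BondConfig V) := ⋃ a ∈ A, (openConn o a : Set (BondConfig V)) with hE
  set Xa : BondConfig V → ℕ := fun ω => (openCluster ω a₀).ncard +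
      (if (openGraph ω).Reachable o a₀ then 1 else 0) with hXa
  set Xo : BondConfig V → ℕ := fun ω => (openCluster ω o).ncard + 1 with hXo
  have hmeas : ∀ S : Set (BondConfig V), MeasurableSet S := fun S => MeasurableSet.of_discrete
  have ea : μ.real (E ∩ {ω | Xa ω ≤ 3}) + μ.real (E \ {ω | Xa ω ≤ 3}) = μ.real E :=
    measureReal_inter_add_sdiff (μ := μ) (hmeas {ω | Xa ω ≤ 3}) (measure_ne_top _ _)
  have eo : μ.real (E ∩ {ω | Xo ω ≤ 3}) + μ.real (E \ {ω | Xo ω ≤ 3}) = μ.real E :=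
    measureReal_inter_add_sdiff (μ := μ) (hmeas {ω | Xo ω ≤ 3}) (measure_ne_top _ _)
  have ha : E \ {ω | Xa ω ≤ 3} = {ω | 4 ≤ Xa ω} ∩ E := by
    ext ω
    simp only [mem_sdiff, mem_inter_iff, mem_setOf_eq, not_le]
    constructor
    · rintro ⟨h1, h2⟩
      exact ⟨by omega, h1⟩
    · rintro ⟨h1, h2⟩
      exact ⟨h2, by omega⟩
  have ho : E \ {ω | Xo ω ≤ 3} = {ω | 4 ≤ Xo ω} ∩ E := by
    ext ω
    simp only [mem_sdiff, mem_inter_iff, mem_setOf_eq, not_le]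
    constructor
    · rintro ⟨h1, h2⟩
      exact ⟨by omega, h1⟩
    · rintro ⟨h1, h2⟩
      exact ⟨h2, by omega⟩
  have key := pendantStar_le_ind w A o a₀ hoA ha₀ hchamp
  rw [← hE] at key
  change μ.real ({ω | Xo ω ≤ 3} ∩ E) ≤ μ.real ({ω | Xa ω ≤ 3} ∩ E) at key
  rw [inter_comm _ E, inter_comm _ E] at key
  rw [ha] at ea
  rw [ho] at eo
  change μ.real ({ω | 4 ≤ Xa ω} ∩ E) ≤ μ.real ({ω | 4 ≤ Xo ω} ∩ E)
  linarith

end PendantStarForms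

open KNPreFKG in
/-- **Kozma–Nitzan 2024, Theorem 9, the threshold `k = 4`** (p. 32: "Conjecture 4 holds for the
functions `f(g) = 𝟙{|C(g)| ≥ k}` for `k ≤ 4`, for any `G` and `A`"; proof omitted in print: "they do
not contain any ideas which we did not already use in § 3").  For every finite weighted graph, every
nonempty `A` and every vertex `0`, some `a ∈ A` has `P(|C(a)| ≥ 4, 0 ↔ A) ≤ P(|C(0)| ≥ 4, 0 ↔ A)`.
Proof (assembled from the §3 tools): `a₀ ∈ A` maximising `P_{G∖{0}}(|C(a)| ≤ 3)` (the choice of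
Theorem 4, p. 13); decompose along the stars `σ_B` of `0` (`real_eq_sum_inter_starEvent`); a star
meeting `A`: Lemma 5 for the monotone cluster property `|·| ≥ 4` (`KozmaNitzan2024_lemma5_cluster`);
a star with two vertices off `A`: on `{0 ↔ A}`, `|C(0)| ≥ 4`; the empty star: `0 ↮ A`; a single
Steiner star `B = {x}`: read on `G ∖ {0}` it is the pendant-star inequality `pendantStar_ge` at `x`,
proved by a second star decomposition at `x`, BHK's Theorem 1.5 (`observerSet_le_of_lonelier`,
`lonelyClusterTransfer_typeMinus`) and the championships of `a₀` in `G ∖ {0}` and of a champion of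
`G ∖ {0, x}`.
[cite: KozmaNitzan2024, Thm. 9 (p. 32) with Conjecture 4 (p. 32), Lemma 5 (p. 13), Thm. 4 (pp. 12–14); VandenbergHaggstromKahn2005, Thm. 1.5 (p. 7)] -/
theorem KozmaNitzan2024_thm9_four {V : Type*} [Fintype V] (w : Sym2 V → unitInterval)
    (A : Finset V) (o : V) (hA : A.Nonempty) :
    ∃ a ∈ A, (prodBernoulli w).real ({ω | 4 ≤ (openCluster ω a).ncard} ∩ ⋃ a' ∈ A, openConn o a') ≤
      (prodBernoulli w).real ({ω | 4 ≤ (openCluster ω o).ncard} ∩ ⋃ a' ∈ A, openConn o a') := by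
  set μ := prodBernoulli w with hμ
  by_cases hoA : o ∈ A
  · exact ⟨o, hoA, le_rfl⟩
  -- the monotone cluster property `|·| ≥ 4`
  set P : Set V → Prop := fun S => 4 ≤ S.ncard with hPdef
  have hP : ∀ S T : Set V, S ⊆ T → P S → P T := le_ncard_mono 4
  have hmeas : ∀ S : Set (BondConfig V), MeasurableSet S := fun S => MeasurableSet.of_discrete
  -- `a₀` maximising `P_{G ∖ {0}}(|C(a)| ≤ 3)` over `A`
  obtain ⟨a₀, ha₀, hmax⟩ := A.exists_max_image
    (fun a => μ.real {ω | ({y | ω ∈ openConnIn ({o}ᶜ : Set V) a y} : Set V).ncard ≤ 3}) hA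
  refine ⟨a₀, ha₀, ?_⟩
  have ha₀o : a₀ ≠ o := fun h => hoA (h ▸ ha₀)
  -- the same choice in the form used by Lemma 5: `a₀` minimises `P_{G∖{0}}(|C(a)| ≥ 4)`
  have hcompl : ∀ a : V, μ.real {ω | P {y | ω ∈ openConnIn ({o}ᶜ : Set V) a y}} =
      1 - μ.real {ω | ({y | ω ∈ openConnIn ({o}ᶜ : Set V) a y} : Set V).ncard ≤ 3} := by
    intro a
    rw [← probReal_compl_eq_one_sub (hmeas _)]
    congr 1
    ext ω
    simp only [hPdef, mem_setOf_eq, mem_compl_iff, not_le]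
    omega
  have hmin : ∀ v ∈ A, μ.real {ω | P {y | ω ∈ openConnIn ({o}ᶜ : Set V) a₀ y}} ≤
      μ.real {ω | P {y | ω ∈ openConnIn ({o}ᶜ : Set V) v y}} := by
    intro v hv
    rw [hcompl, hcompl]
    linarith [hmax v hv]
  -- the stars of `0` over ALL `B ⊆ V ∖ {0}` partition the space
  set U : Finset V := Finset.univ.erase o with hU
  have hoU : o ∉ U := fun h => (Finset.mem_erase.1 h).1 rfl
  have hisoU : ∀ u, u ≠ o → u ∉ U → w s(o, u) = 0 :=
    fun u huo huU => absurd (Finset.mem_erase.2 ⟨huo, Finset.mem_univ u⟩) huU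
  change μ.real ({ω | P (openCluster ω a₀)} ∩ ⋃ a' ∈ A, openConn o a') ≤
    μ.real ({ω | P (openCluster ω o)} ∩ ⋃ a' ∈ A, openConn o a')
  rw [real_eq_sum_inter_starEvent w U o hoU hisoU ({ω | P (openCluster ω a₀)} ∩ _),
    real_eq_sum_inter_starEvent w U o hoU hisoU ({ω | P (openCluster ω o)} ∩ _)]
  refine Finset.sum_le_sum fun B hB => ?_
  have hBU : B ⊆ U := Finset.mem_powerset.1 hB
  have hBo : ∀ u ∈ B, u ≠ o := fun u hu h => hoU (h ▸ hBU hu)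
  by_cases hBA : ∃ v ∈ B, v ∈ A
  · -- a star meeting `A`: Lemma 5 with `v ∈ B ∩ A`, and `σ_B ⊆ {0 ↔ v} ⊆ {0 ↔ A}`
    obtain ⟨v, hvB, hvA⟩ := hBA
    have hvo : v ≠ o := hBo v hvB
    have L5 := KozmaNitzan2024_lemma5_cluster w o a₀ v (↑B) P hP ha₀o hvo (Finset.mem_coe.2 hvB)
      (hmin v hvA)
    have hσU : starEvent o (↑B : Set V) ⊆ ⋃ a' ∈ A, (openConn o a' : Set (BondConfig V)) := by
      intro ω hσ
      exact mem_iUnion₂.2 ⟨v, hvA, mem_openCluster_of_mem_starEvent hσ hvo (Finset.mem_coe.2 hvB)⟩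
    calc μ.real (({ω | P (openCluster ω a₀)} ∩ ⋃ a' ∈ A, openConn o a') ∩ starEvent o ↑B)
        ≤ μ.real ({ω | P (openCluster ω a₀)} ∩ starEvent o ↑B) :=
          measureReal_mono fun ω ⟨⟨h1, _⟩, h2⟩ => ⟨h1, h2⟩
      _ ≤ μ.real ({ω | P (openCluster ω o)} ∩ starEvent o ↑B) := L5
      _ ≤ μ.real (({ω | P (openCluster ω o)} ∩ ⋃ a' ∈ A, openConn o a') ∩ starEvent o ↑B) :=
          measureReal_mono fun ω ⟨h1, h2⟩ => ⟨⟨h1, hσU h2⟩, h2⟩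
  · push Not at hBA
    rcases B.eq_empty_or_nonempty with rfl | ⟨u, hu⟩
    · -- the empty star: `0 ↮ A`, the term vanishes
      have h0 : ({ω | P (openCluster ω a₀)} ∩ ⋃ a' ∈ A, openConn o a') ∩ starEvent o ↑(∅ : Finset V) =
          (∅ : Set (BondConfig V)) := by
        ext ω
        simp only [mem_inter_iff, mem_iUnion, exists_prop, mem_empty_iff_false, iff_false, not_and]
        rintro ⟨-, a', ha', hoa'⟩ hσ
        rw [Finset.coe_empty] at hσ
        exact not_reachable_of_mem_starEvent_empty hσ (fun h => hoA (h ▸ ha')) hoa'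
      rw [h0, measureReal_empty]
      exact measureReal_nonneg
    have huo : u ≠ o := hBo u hu
    have huA : u ∉ A := hBA u hu
    by_cases hB2 : ∃ u' ∈ B, u' ≠ u
    · -- a star with two vertices off `A`: on `{0 ↔ A}`, `C(0) ∋ 0, u, u', a'` — four vertices
      obtain ⟨u', hu', hu'u⟩ := hB2
      have hu'o : u' ≠ o := hBo u' hu'
      have hu'A : u' ∉ A := hBA u' hu'
      refine measureReal_mono ?_
      rintro ω ⟨⟨-, hE⟩, hσ⟩
      obtain ⟨a', ha', hoa'⟩ := mem_iUnion₂.1 hE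
      have ha'o : a' ≠ o := fun h => hoA (h ▸ ha')
      have ha'u : a' ≠ u := fun h => huA (h ▸ ha')
      have ha'u' : a' ≠ u' := fun h => hu'A (h ▸ ha')
      refine ⟨⟨?_, hE⟩, hσ⟩
      change 4 ≤ (openCluster ω o).ncard
      have hfin : (openCluster ω o).Finite := Set.toFinite _
      have h3 : 3 ≤ (openCluster ω o \ {o}).ncard :=
        three_le_ncard_of_mem
          (show u ∈ openCluster ω o \ {o} from
            ⟨mem_openCluster_of_mem_starEvent hσ huo (Finset.mem_coe.2 hu), huo⟩)
          (show u' ∈ openCluster ω o \ {o} from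
            ⟨mem_openCluster_of_mem_starEvent hσ hu'o (Finset.mem_coe.2 hu'), hu'o⟩)
          (show a' ∈ openCluster ω o \ {o} from ⟨hoa', ha'o⟩) hu'u.symm ha'u.symm ha'u'.symm
      have h4 := Set.ncard_sdiff_singleton_add_one (mem_openCluster_self ω o) hfin
      omega
    · -- a single Steiner star `B = {u}`: the pendant-star inequality on `G ∖ {0}` at `u`
      push Not at hB2
      have hBeq : B = {u} := Finset.eq_singleton_iff_unique_mem.2 ⟨hu, hB2⟩
      subst hBeq
      -- the graph `G ∖ {0}`
      set w' : Sym2 ({o}ᶜ : Set V) → unitInterval :=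
        w ∘ Sym2.map (Subtype.val : ({o}ᶜ : Set V) → V) with hw'
      set μ' := prodBernoulli w' with hμ'
      set a₀' : ({o}ᶜ : Set V) := ⟨a₀, mem_compl_singleton_iff.2 ha₀o⟩ with ha₀'
      set u' : ({o}ᶜ : Set V) := ⟨u, mem_compl_singleton_iff.2 huo⟩ with hu'def
      set AS : Finset ({o}ᶜ : Set V) :=
        Finset.univ.filter fun a : ({o}ᶜ : Set V) => (a : V) ∈ A with hAS
      have ha₀'A : a₀' ∈ AS := Finset.mem_filter.2 ⟨Finset.mem_univ _, ha₀⟩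
      have hu'A : u' ∉ AS := fun h => huA (Finset.mem_filter.1 h).2
      -- championship of `a₀` on `G ∖ {0}`
      have hH : ∀ v : ({o}ᶜ : Set V), μ'.real {ω' | (openCluster ω' v).ncard ≤ 3} =
          μ.real {ω | ({y | ω ∈ openConnIn ({o}ᶜ : Set V) (v : V) y} : Set V).ncard ≤ 3} := by
        intro v
        rw [hμ', hw', ← real_preimage_restrictConfig_val]
        congr 1
        ext ω
        rw [mem_preimage, mem_setOf_eq, mem_setOf_eq, ncard_openCluster_restrictConfig]
      have hchampH : ∀ a ∈ AS, μ'.real {ω' | (openCluster ω' a).ncard ≤ 3} ≤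
          μ'.real {ω' | (openCluster ω' a₀').ncard ≤ 3} := by
        intro a ha
        rw [hH, hH]
        exact hmax a (Finset.mem_filter.1 ha).2
      have key := pendantStar_ge w' AS u' a₀' hu'A ha₀'A hchampH
      -- the set of vertices joined off `0` to `u`
      have hCT : ∀ ω : BondConfig V,
          ({y | ∃ v ∈ ((↑({u} : Finset V)) : Set V), v ≠ o ∧ ω ∈ openConnIn ({o}ᶜ : Set V) v y} :
            Set V) = {y | ω ∈ openConnIn ({o}ᶜ : Set V) u y} := by
        intro ω
        ext y
        simp only [Finset.coe_singleton, mem_singleton_iff, mem_setOf_eq]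
        constructor
        · rintro ⟨v, rfl, -, h⟩
          exact h
        · exact fun h => ⟨u, rfl, huo, h⟩
      -- transport of the `a₀`-side
      have hsub1 : ({ω : BondConfig V | P (openCluster ω a₀)} ∩ ⋃ a' ∈ A, openConn o a') ∩
            starEvent o ↑({u} : Finset V) ⊆
          starEvent o ↑({u} : Finset V) ∩
            restrictConfig (Subtype.val : ({o}ᶜ : Set V) → V) ⁻¹'
              ({ω' | 4 ≤ (openCluster ω' a₀').ncard +
                  (if (openGraph ω').Reachable u' a₀' then 1 else 0)} ∩
                ⋃ a ∈ AS, (openConn u' a : Set (BondConfig ({o}ᶜ : Set V)))) := by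
        rintro ω ⟨⟨hPa, hE⟩, hσ⟩
        refine ⟨hσ, ?_⟩
        rw [mem_preimage]
        refine ⟨?_, ?_⟩
        · change 4 ≤ (openCluster (restrictConfig Subtype.val ω) a₀').ncard +
            (if (openGraph (restrictConfig Subtype.val ω)).Reachable u' a₀' then 1 else 0)
          rw [ncard_openCluster_restrictConfig]
          have hPa' : 4 ≤ (openCluster ω a₀).ncard := hPa
          by_cases hc : ∃ v ∈ ((↑({u} : Finset V)) : Set V), v ≠ o ∧
              ω ∈ openConnIn ({o}ᶜ : Set V) a₀ v
          · have hua₀ : ω ∈ openConnIn ({o}ᶜ : Set V) u a₀ := by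
              obtain ⟨v, hv, -, ⟨h1, h2, hr⟩⟩ := hc
              rw [Finset.coe_singleton, mem_singleton_iff] at hv
              subst hv
              exact ⟨h2, h1, hr.symm⟩
            have hreach : (openGraph (restrictConfig Subtype.val ω)).Reachable u' a₀' :=
              (reachable_restrictConfig_val_iff _ ω u' a₀').2 hua₀
            have hnot : o ∉ ({y | ω ∈ openConnIn ({o}ᶜ : Set V) u y} : Set V) := by
              rintro ⟨-, h, -⟩
              exact absurd rfl (mem_compl_singleton_iff.1 h)
            rw [if_pos hreach]
            rw [openCluster_eq_of_mem_starEvent_of_conn hσ ha₀o hc, hCT,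
              Set.ncard_insert_of_notMem hnot (Set.toFinite _)] at hPa'
            have hau : ω ∈ openConnIn ({o}ᶜ : Set V) a₀ u := by
              obtain ⟨h1, h2, hr⟩ := hua₀
              exact ⟨h2, h1, hr.symm⟩
            have heq : ({y | ω ∈ openConnIn ({o}ᶜ : Set V) a₀ y} : Set V) =
                {y | ω ∈ openConnIn ({o}ᶜ : Set V) u y} := by
              ext y
              simp only [mem_setOf_eq]
              exact ⟨fun h => openConnIn_trans hua₀ h, fun h => openConnIn_trans hau h⟩
            rw [heq]
            exact hPa'
          · have hn : ∀ v ∈ ((↑({u} : Finset V)) : Set V), v ≠ o →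
                ω ∉ openConnIn ({o}ᶜ : Set V) a₀ v := fun v hv hvo h => hc ⟨v, hv, hvo, h⟩
            rw [openCluster_eq_of_mem_starEvent_of_not hσ ha₀o hn] at hPa'
            exact le_add_right hPa'
        · obtain ⟨a', ha', hoa'⟩ := mem_iUnion₂.1 hE
          have ha'o : a' ≠ o := fun h => hoA (h ▸ ha')
          obtain ⟨v, hv, -, hva'⟩ :=
            (reachable_center_iff_of_mem_starEvent hσ ha'o).1 hoa'
          rw [Finset.coe_singleton, mem_singleton_iff] at hv
          subst hv
          refine mem_iUnion₂.2 ⟨⟨a', mem_compl_singleton_iff.2 ha'o⟩,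
            Finset.mem_filter.2 ⟨Finset.mem_univ _, ha'⟩, ?_⟩
          exact (reachable_restrictConfig_val_iff _ ω u' ⟨a', _⟩).2 hva'
      -- transport of the `0`-side
      have hsub2 : starEvent o ↑({u} : Finset V) ∩
            restrictConfig (Subtype.val : ({o}ᶜ : Set V) → V) ⁻¹'
              ({ω' | 4 ≤ (openCluster ω' u').ncard + 1} ∩
                ⋃ a ∈ AS, (openConn u' a : Set (BondConfig ({o}ᶜ : Set V)))) ⊆
          ({ω : BondConfig V | P (openCluster ω o)} ∩ ⋃ a' ∈ A, openConn o a') ∩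
            starEvent o ↑({u} : Finset V) := by
        rintro ω ⟨hσ, hω⟩
        rw [mem_preimage] at hω
        obtain ⟨hPu, hE⟩ := hω
        refine ⟨⟨?_, ?_⟩, hσ⟩
        · change 4 ≤ (openCluster ω o).ncard
          have hPu' : 4 ≤ (openCluster (restrictConfig Subtype.val ω) u').ncard + 1 := hPu
          rw [ncard_openCluster_restrictConfig] at hPu'
          have hnot : o ∉ ({y | ω ∈ openConnIn ({o}ᶜ : Set V) u y} : Set V) := by
            rintro ⟨-, h, -⟩
            exact absurd rfl (mem_compl_singleton_iff.1 h)
          rw [openCluster_center_eq_of_mem_starEvent hσ, hCT,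
            Set.ncard_insert_of_notMem hnot (Set.toFinite _)]
          exact hPu'
        · obtain ⟨a, ha, hua⟩ := mem_iUnion₂.1 hE
          have haA : ((a : ({o}ᶜ : Set V)) : V) ∈ A := (Finset.mem_filter.1 ha).2
          refine mem_iUnion₂.2 ⟨(a : V), haA, ?_⟩
          change (openGraph ω).Reachable o a
          refine (reachable_center_iff_of_mem_starEvent hσ (mem_compl_singleton_iff.1 a.2)).2
            ⟨u, ?_, huo, (reachable_restrictConfig_val_iff _ ω u' a).1 hua⟩
          rw [Finset.coe_singleton]
          exact mem_singleton u
      calc μ.real (({ω | P (openCluster ω a₀)} ∩ ⋃ a' ∈ A, openConn o a') ∩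
            starEvent o (↑({u} : Finset V)))
          ≤ μ.real (starEvent o ↑({u} : Finset V) ∩
              restrictConfig (Subtype.val : ({o}ᶜ : Set V) → V) ⁻¹'
                ({ω' | 4 ≤ (openCluster ω' a₀').ncard +
                    (if (openGraph ω').Reachable u' a₀' then 1 else 0)} ∩
                  ⋃ a ∈ AS, (openConn u' a : Set (BondConfig ({o}ᶜ : Set V))))) :=
            measureReal_mono hsub1
        _ = μ.real (starEvent o ↑({u} : Finset V)) * μ'.real
              ({ω' | 4 ≤ (openCluster ω' a₀').ncard +
                  (if (openGraph ω').Reachable u' a₀' then 1 else 0)} ∩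
                ⋃ a ∈ AS, (openConn u' a : Set (BondConfig ({o}ᶜ : Set V)))) := by
            rw [real_starEvent_inter_preimage, hμ', hw', real_preimage_restrictConfig_val]
        _ ≤ μ.real (starEvent o ↑({u} : Finset V)) * μ'.real
              ({ω' | 4 ≤ (openCluster ω' u').ncard + 1} ∩
                ⋃ a ∈ AS, (openConn u' a : Set (BondConfig ({o}ᶜ : Set V)))) :=
            mul_le_mul_of_nonneg_left key measureReal_nonneg
        _ = μ.real (starEvent o ↑({u} : Finset V) ∩
              restrictConfig (Subtype.val : ({o}ᶜ : Set V) → V) ⁻¹'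
                ({ω' | 4 ≤ (openCluster ω' u').ncard + 1} ∩
                  ⋃ a ∈ AS, (openConn u' a : Set (BondConfig ({o}ᶜ : Set V))))) := by
            rw [real_starEvent_inter_preimage, hμ', hw', real_preimage_restrictConfig_val]
        _ ≤ μ.real (({ω | P (openCluster ω o)} ∩ ⋃ a' ∈ A, openConn o a') ∩
            starEvent o (↑({u} : Finset V))) :=
            measureReal_mono hsub2

/-- **Theorem 9 at `k = 4`, in the "`E f(0)𝟙 ≥ min_a E f(a)𝟙`" wording of Conjecture 4**: the minimum
over `A` of `P(|C(a)| ≥ 4, 0 ↔ A)` is at most `P(|C(0)| ≥ 4, 0 ↔ A)`.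
[cite: KozmaNitzan2024, Thm. 9 and Conjecture 4 (p. 32)] -/
theorem KozmaNitzan2024_thm9_four_inf {V : Type*} [Fintype V] (w : Sym2 V → unitInterval)
    (A : Finset V) (o : V) (hA : A.Nonempty) :
    A.inf' hA (fun a => (prodBernoulli w).real
        ({ω | 4 ≤ (openCluster ω a).ncard} ∩ ⋃ a' ∈ A, openConn o a')) ≤
      (prodBernoulli w).real ({ω | 4 ≤ (openCluster ω o).ncard} ∩ ⋃ a' ∈ A, openConn o a') := by
  obtain ⟨a, ha, h⟩ := KozmaNitzan2024_thm9_four w A o hA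
  exact (Finset.inf'_le _ ha).trans h

/-- **Kozma–Nitzan 2024, Theorem 9, as printed: all thresholds `k ≤ 4`.**  For every finite weighted
graph, every nonempty `A`, every vertex `0` and every `k ≤ 4`, some `a ∈ A` has
`P(|C(a)| ≥ k, 0 ↔ A) ≤ P(|C(0)| ≥ k, 0 ↔ A)`.
[cite: KozmaNitzan2024, Thm. 9 (p. 32) with Conjecture 4 (p. 32)] -/
theorem KozmaNitzan2024_thm9 {V : Type*} [Fintype V] (w : Sym2 V → unitInterval)
    (A : Finset V) (o : V) (k : ℕ) (hk : k ≤ 4) (hA : A.Nonempty) :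
    ∃ a ∈ A, (prodBernoulli w).real ({ω | k ≤ (openCluster ω a).ncard} ∩ ⋃ a' ∈ A, openConn o a') ≤
      (prodBernoulli w).real ({ω | k ≤ (openCluster ω o).ncard} ∩ ⋃ a' ∈ A, openConn o a') := by
  rcases Nat.lt_or_ge k 4 with h | h
  · exact KozmaNitzan2024_thm9_le_three w A o k (by omega) hA
  · have hk4 : k = 4 := le_antisymm hk h
    subst hk4
    exact KozmaNitzan2024_thm9_four w A o hA

end KFour

end Literature.Probability.Percolation

end
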